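import Mathlib
import Literature.AlgebraicGeometry.Resolution.PolygonMinimality
import Literature.AlgebraicGeometry.Resolution.PolygonTranslation
import Literature.AlgebraicGeometry.Resolution.TotalPreparation
import Literature.AlgebraicGeometry.Resolution.MonicTransport
import Literature.AlgebraicGeometry.Resolution.AdaptedOfPrepared
import HarnessLib

/-!
# Very well prepared parameters (Cutkosky 2009, Definition 10.8): Lemma 10.7 for all reachable systems and Lemma 10.9 (existence)

Topic: `Literature/AlgebraicGeometry/Resolution`. S. D. Cutkosky, *Resolution of singularities for
3-folds in positive characteristic*, Amer. J. Math. **131** (2009) 59–127, §10.3 "Very well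
preparation" (author version `paper:doi-10-1353-ajm-0-0036`, read on the page: p. 30 l. 28 – p. 31
l. 33). After the translations `y₁ = y − ηxⁿ` (p. 30 l. 28–30), Lemma 10.6 and

> **Lemma 10.7.** Suppose that `(I; x, y, z)` is well prepared, `y₁ = y − ηxⁿ` is a translation, and
> `z₁ = z − ψ(x, y₁)` is a subsequent well preparation. Then `α_{x,y₁,z₁}(I) = α_{xyz}(I)`,
> `β_{x,y₁,z₁}(I) = β_{xyz}(I)` and `γ_{x,y₁,z₁}(I) = γ_{xyz}(I)`.

the text defines (p. 30 l. 70 – p. 31 l. 14) and proves (p. 31 l. 15–33):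

> **Definition 10.8.** Suppose that `I ⊂ R` is an ideal such that `ν_T(I) = r`, `τ(I) = 1`, `Sing_r(I)`
> has dimension `< 2` and `(x, y, z)` are good parameters for `I`. Let `α = α_{xyz}(I)`, `β = β_{xyz}(I)`,
> `γ = γ_{xyz}(I)`, `δ = δ_{xyz}(I)`, `ε = ε_{xyz}(I)`. `(I; x, y, z)` will be said to be very well prepared
> if it is well prepared and one of the following conditions holds.
> 1. `(γ − δ, δ) ≠ (α, β)` and if we make a translation `y₁ = y − ηx`, with subsequent well preparation
>    `z₁ = z − Ψ(x, y₁)`, then `α_{xy₁z₁}(I) = α`, `β_{xy₁z₁}(I) = β`, `γ_{xy₁z₁}(I) = γ` and `δ_{xy₁z₁}(I) ≤ δ`.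
> 2. `(γ − δ, δ) = (α, β)` and one of the following cases hold: a. `ε = 0`  b. `ε ≠ 0` and `1/ε` is
>    not an integer  c. `ε ≠ 0` and `n = 1/ε` is a (positive) integer and for any `η ∈ k`, if
>    `y₁ = y − ηxⁿ` is a translation, with subsequent well preparation `z₁ = z − Ψ(x, y₁)`, then
>    `ε_{xy₁z₁}(I) = ε`. Further, if `(c, d)` is the lowest point on the line through `(α, β)` with
>    slope `−ε` in `|Δ(I; x, y, z)|` and `(c₁, d₁)` is the lowest point on this line in `|Δ(I; x, y₁, z₁)|`,
>    then `d₁ ≤ d`.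
>
> **Lemma 10.9.** Suppose that `I ⊂ T` is an ideal such that `ν_T(I) = r`, `τ(I) = 1`, `Sing_r(I)` has
> dimension `< 2` and `(x, y, z)` are good parameters for `I`. Then there are formal substitutions
> `z₁ = z − Ψ(x, y)`, `y₁ = y − φ(x)` where `Ψ(x, y)`, `φ(x)` are series such that `(I; x, y₁, z₁)` is very
> well prepared.
> *Proof.* By Lemmas 10.4 and 10.7, we can find good parameters `x, y, z` for `I` such that `(I; x, y, z)`
> is well prepared, `α, β, γ` do not change under translation `y₁ = y − ηx` followed by subsequent well
> preparation, and `δ` is maximal. If `(γ − δ, δ) ≠ (α, β)`, then we have achieved case 1 of Definition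
> 10.8 […]. We now assume that `(I; x, y, z)` is well prepared, and `(α, β) = (γ − δ, δ)`. If `ε = 0` or
> `1/ε` is not an integer then `(I; x, y, z)` is very well prepared. Suppose that `n = 1/ε` is an integer.
> We then choose `η ∈ k` such that with the translation `y₁ = y − ηxⁿ`, and subsequent well preparation,
> we maximize `d` for points `(c, d)` of the line through `(α, β)` with slope `−ε` on the boundary of
> `|Δ(I; x, y₁, z₁)|`. By Lemma 10.7, `α, β` and `γ` are not changed. If we now have that `d ≠ β`, we are
> very well prepared. If the process does not end after a finite number of iterations, then we construct
> formal series `y' = y − φ(x)` and `z' = z − ψ(x, y)` such that `|Δ(I; x, y', z')|` has the single vertex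
> `(α, β)`, and `(I; x, y', z')` is thus very well prepared.

("well prepared" = all vertices of `|Δ|` prepared, p. 29 l. 13–16; `ε` = "the absolute value of the
largest slope of a line through `(α, β)` such that no points of `|Δ|` lie below it", p. 28 l. 35–37.)

## Dictionary (as in `CutkoskySurfaceOmega.lean`, `PolygonTranslation.lean`, `TotalPreparation.lean`)

Cutkosky's `(z, x, y)` is the tree's `c = (c 0, c 1, c 2) = (y, u₁, u₂)`; `r ↔ μ`; all polygon data
are the `L = μ!`-scaled integers of `PolygonInvariants`: `L·α = alphaS`, `L·β = betaS`,
**`L·γ = deltaS`** (CJS `δ`), **`L·δ = gammaMinusS`** (CJS `γ⁻`: the ordinate of the lowest point of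
the polygon on the first line of slope `−1`), so Cutkosky's vertex `(γ − δ, δ)` is CJS's `w⁻`;
`ε = Cutkosky2009.epsCu`, `1/ε = Cutkosky2009.invEpsCu` (`⊤ = ∞`). The translation `y₁ = y − ηxⁿ` is
the shear `shiftU₂ c φ = (y, u₁, u₂ + φu₁)` with `u₁^{n−1} ∣ φ` (`SolvableVertexTransport`,
`PolygonTranslation`); a well preparation `z₁ = z − Ψ(x, y₁)` is a change `shiftZ · t = (y + t, u₁, u₂')`
with `t ∈ (u₁, u₂)` after which every vertex is prepared (`∀ B, PreparedUpTo · J μ B`,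
`BoundedPreparation` / `TotalPreparation`); "the lowest point on the line through `(α, β)` with slope
`−ε = −1/n`" is the least ordinate on the line `x₁ + n x₂ = αs + n βs` (`lowOrdS`).

TREE FORM OF THE QUANTIFIERS (honest): the conditions of Definition 10.8 quantify over Cutkosky's
translations (`η ∈ k`) and well preparations (`Ψ ∈ k⟦x, y₁⟧`); the tree predicate
`Cutkosky2009.VeryWellPrepared` quantifies over ALL `φ ∈ R` with `u₁^{n−1} ∣ φ` and ALL `t ∈ (u₁, u₂)R`
making the result well prepared. For `R = k⟦x, y, z⟧` these families contain the printed ones, so the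
tree predicate IMPLIES the printed notion (it is the form in which Lemma 10.9 will be proved and in
which Lemmas 10.13–10.14 / Theorem 10.17 consume it). The hypotheses "`ν_T(I) = r`, `τ(I) = 1`,
`Sing_r(I)` has dimension `< 2`, good parameters" are hypotheses of the theorems, not fields of the
predicate.

## What this file PROVES (theorems only; no named facts)

* bookkeeping of the reachable systems `c' = (y + t, u₁, u₂ + φu₁)` (compositions, generated ideals);
  `HasMonic` (good parameters) is kept by every such change (`hasMonic_reach`);
* `WellPrepared.vPrepared / wMinusPrepared / wPlusPrepared`; a well prepared reachable system has
  the SMALLER polygon (`forall_pts_reach_of_wellPrepared`, from `PolygonMinimality`);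
* **Lemma 10.7 for every translation and every subsequent well preparation**
  (`alphaS_betaS_deltaS_reach_eq`): `α, β, γ` (tree `αs, βs, δs`) are unchanged — `v` persists by
  `v`-preparedness (`alphaS_betaS_shiftZ_eq_of_vPrepared`), `γ = δs` persists through the UPPER vertex
  `w⁺` of the first face of slope `−1`, which survives every shear (`exists_pts_shiftU₂_wPlus`) and,
  being prepared, every re-preparation (`deltaS_gammaPlusS_shiftZ_eq_of_wPlusPrepared`, this file);
  for `n ≥ 2` also Cutkosky's `δ` (tree `γ⁻s`) is unchanged (`gammaMinusS_reach_eq_of_pow_dvd`);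
* `invEpsCu_eq_natCast_iff`: "`1/ε = n`" ⟺ the polygon lies in the half-plane `x₁ + n x₂ ≥ αs + nβs`
  and has a point other than `v` on its boundary (`lowOrdS … < βs`);
* the predicate `Cutkosky2009.VeryWellPrepared` with its case lemmas;
* **Lemma 10.9** following the printed proof: `exists_reach_isMax_gammaMinusS` ("`δ` is maximal"),
  `round_step` (one round: maximise `d` along the line of slope `−1/n`; either very well prepared, or the
  edge is removed and `1/ε` grows), and `exists_veryWellPrepared_of_wellPrepared` — in a COMPLETE `R`,
  from a well prepared good system with `δs > L` and `J ⊄ ((y + t)^μ)` for all `t ∈ (u₁, u₂)` (the tree's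
  reading of "`Sing_r(I)` has dimension `< 2`", as in `TotalPreparation`), some translation + well
  preparation `(y + t, u₁, u₂ + φu₁)` is very well prepared; the non-terminating case is the `𝔪`-adic
  limit of the translations followed by ONE total preparation (`TotalPreparation`), whose polygon lies
  in every half-plane `x₁ + n_k x₂ ≥ αs + n_k βs` (`n_k → ∞`) by minimality, Lemma 10.6 and
  `weightedIdealW_le_of_forall_sub_mem_pow`, so that "`|Δ|` has the single vertex `(α, β)`" below the
  level `β` (`ε = 0`, case 2a).

Honest differences from the print: `φ` ranges over `R` and `Ψ` over `(u₁, u₂)R` (see above); the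
conclusion of Lemma 10.9 is existence of SOME very well prepared reachable system, not of substitutions
of the printed shape `φ ∈ k⟦x⟧`, `Ψ ∈ k⟦x, y⟧` (TODO(printed form); not needed by Theorem 10.18).
AI-written formalization, read against the text layer of the held copy; weaker than expert review.

## Sources

* S. D. Cutkosky, Amer. J. Math. 131 (2009) 59–127: §10.1 p. 28 l. 26–53 (`α, β, γ, δ, ε, Ω`);
  §10.2 p. 29 l. 5–16 (prepared, well prepared); §10.3 p. 30 l. 28 – p. 31 l. 33 (translations,
  Lemma 10.6, Lemma 10.7, Definition 10.8, Lemma 10.9). [Cutkosky2009]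
* V. Cossart, U. Jannsen, S. Saito, LNM 2270 (2020), Def. 11.1 (`α, β, δ, γ±`), Lemma 13.6.
  [CossartJannsenSaito2020]
* H. Hironaka, J. Math. Kyoto Univ. 7 (1967), Thm. (4.8) (minimality of the prepared polygon, via
  `PolygonMinimality`). [Hironaka1967]
-/

noncomputable section

open IsLocalRing MvPolynomial

namespace Literature.AlgebraicGeometry.Resolution

universe u

variable {R : Type u} [CommRing R]

/-! ## Bookkeeping of the moves `y ↦ y + t`, `u₂ ↦ u₂ + φ u₁` -/

section Moves

/-- Two translations compose to a translation: `(u₂ + φu₁) + ψu₁ = u₂ + (φ + ψ)u₁` (the partial sums of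
Lemma 10.9's "`y₁ = y − φ(x)`"). [cite: Cutkosky2009, §10.3 p. 30 l. 28–30; Lemma 10.9 p. 31 l. 18–20] -/
theorem shiftU₂_shiftU₂ (c : Fin 3 → R) (phi psi : R) :
    shiftU₂ (shiftU₂ c phi) psi = shiftU₂ c (phi + psi) := by
  funext i
  fin_cases i
  · rfl
  · rfl
  · show c 2 + phi * c 1 + psi * c 1 = c 2 + (phi + psi) * c 1
    ring

/-- Two preparations compose: `(y + s) + t = y + (s + t)` (the partial sums of Lemma 10.4's / 10.9's
"`z₁ = z − Ψ(x, y)`"). [cite: Cutkosky2009, Lemma 10.4 p. 30 l. 19–24; Lemma 10.9 p. 31 l. 18–20] -/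
theorem shiftZ_shiftZ (c : Fin 3 → R) (s t : R) : shiftZ (shiftZ c s) t = shiftZ c (s + t) := by
  funext i
  fin_cases i
  · show c 0 + s + t = c 0 + (s + t)
    ring
  · rfl
  · rfl

/-- A translation and a preparation commute (`y`, resp. `u₂`, is the only changed parameter).
[cite: Cutkosky2009, §10.3 p. 30 l. 28–30] -/
theorem shiftU₂_shiftZ (c : Fin 3 → R) (t phi : R) :
    shiftU₂ (shiftZ c t) phi = shiftZ (shiftU₂ c phi) t := by
  funext i
  fin_cases i <;> rfl

/-- The trivial preparation `z₁ = z`. [cite: Cutkosky2009, Lemma 10.4 p. 30 l. 19–24] -/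
theorem shiftZ_zero_eq (c : Fin 3 → R) : shiftZ c 0 = c := by
  funext i
  fin_cases i
  · show c 0 + 0 = c 0
    rw [add_zero]
  · rfl
  · rfl

/-- The trivial translation `η = 0`. [cite: Cutkosky2009, §10.3 p. 30 l. 28–30] -/
theorem shiftU₂_zero_eq (c : Fin 3 → R) : shiftU₂ c 0 = c := by
  funext i
  fin_cases i
  · rfl
  · rfl
  · show c 2 + 0 * c 1 = c 2
    ring

/-- The ideal `(x, y₁) = (x, y)` is unchanged by a translation `y₁ = y − ηxⁿ` (so "`Ψ(x, y₁)`" and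
"`Ψ(x, y)`" range over the same ideal). [cite: Cutkosky2009, §10.3 p. 30 l. 28–30; Def. 10.8 p. 30 l. 74–75] -/
theorem span_pair_shiftU₂ (c : Fin 3 → R) (phi : R) :
    Ideal.span ({shiftU₂ c phi 1, shiftU₂ c phi 2} : Set R) = Ideal.span ({c 1, c 2} : Set R) := by
  simp only [shiftU₂_one, shiftU₂_two]
  apply le_antisymm
  · rw [Ideal.span_le]
    rintro x (rfl | rfl)
    · exact Ideal.subset_span (by simp)
    · exact Ideal.add_mem _ (Ideal.subset_span (by simp))
        (Ideal.mul_mem_left _ _ (Ideal.subset_span (by simp)))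
  · rw [Ideal.span_le]
    rintro x (rfl | rfl)
    · exact Ideal.subset_span (by simp)
    · have : c 2 = (c 2 + phi * c 1) - phi * c 1 := by ring
      rw [SetLike.mem_coe, this]
      exact Ideal.sub_mem _ (Ideal.subset_span (by simp))
        (Ideal.mul_mem_left _ _ (Ideal.subset_span (by simp)))

/-- The ideal `(x, y)` is unchanged by a preparation `z₁ = z − Ψ` (bookkeeping). [cite: Cutkosky2009, Lemma 10.4 p. 30 l. 19–24] -/
theorem span_pair_shiftZ (c : Fin 3 → R) (t : R) :
    Ideal.span ({shiftZ c t 1, shiftZ c t 2} : Set R) = Ideal.span ({c 1, c 2} : Set R) := by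
  simp only [shiftZ_one, shiftZ_two]

/-- A preparation `z₁ = z − Ψ`, `Ψ ∈ (x, y)`, keeps the regular system of parameters: `(z₁, x, y)`
generates the same ideal ("`(x, y, z₁)` are good parameters"). [cite: Cutkosky2009, Lemma 10.4 p. 30 l. 19–22] -/
theorem span_triple_shiftZ_of_mem_span_pair (c : Fin 3 → R) {t : R}
    (ht : t ∈ Ideal.span ({c 1, c 2} : Set R)) :
    Ideal.span {shiftZ c t 0, shiftZ c t 1, shiftZ c t 2} = Ideal.span {c 0, c 1, c 2} := by
  simp only [shiftZ_zero, shiftZ_one, shiftZ_two]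
  have hsub : Ideal.span ({c 1, c 2} : Set R) ≤ Ideal.span {c 0, c 1, c 2} :=
    Ideal.span_mono (by intro x hx; simp only [Set.mem_insert_iff, Set.mem_singleton_iff] at hx ⊢; tauto)
  have hsub' : Ideal.span ({c 1, c 2} : Set R) ≤ Ideal.span {c 0 + t, c 1, c 2} :=
    Ideal.span_mono (by intro x hx; simp only [Set.mem_insert_iff, Set.mem_singleton_iff] at hx ⊢; tauto)
  apply le_antisymm
  · rw [Ideal.span_le]
    rintro x (rfl | rfl | rfl)
    · exact Ideal.add_mem _ (Ideal.subset_span (by simp)) (hsub ht)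
    · exact Ideal.subset_span (by simp)
    · exact Ideal.subset_span (by simp)
  · rw [Ideal.span_le]
    rintro x (rfl | rfl | rfl)
    · have hmem : (c 0 + t) - t ∈ Ideal.span ({c 0 + t, c 1, c 2} : Set R) :=
        Ideal.sub_mem _ (Ideal.subset_span (by simp)) (hsub' ht)
      rw [SetLike.mem_coe]
      convert hmem using 1
      ring
    · exact Ideal.subset_span (by simp)
    · exact Ideal.subset_span (by simp)

/-- **The reachable system** `(y + t, u₁, u₂ + φu₁)` (a translation followed by a preparation)
generates `𝔪` when `(y, u₁, u₂)` does and `t ∈ (u₁, u₂)`: translations and preparations produce regular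
parameters. [cite: Cutkosky2009, Lemma 10.4 p. 30 l. 19–22; Lemma 10.9 p. 31 l. 15–20] -/
theorem span_triple_reach [IsLocalRing R] (c : Fin 3 → R)
    (hgen : Ideal.span {c 0, c 1, c 2} = maximalIdeal R) (phi : R) {t : R}
    (ht : t ∈ Ideal.span ({c 1, c 2} : Set R)) :
    Ideal.span {shiftZ (shiftU₂ c phi) t 0, shiftZ (shiftU₂ c phi) t 1, shiftZ (shiftU₂ c phi) t 2} =
      maximalIdeal R := by
  rw [span_triple_shiftZ_of_mem_span_pair (shiftU₂ c phi) (by rwa [span_pair_shiftU₂]),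
    span_triple_shiftU₂, hgen]

/-- Composition of two reachable changes is a reachable change (translations add, preparations add):
the iteration of Lemma 10.9's proof stays inside one family of substitutions.
[cite: Cutkosky2009, Lemma 10.9 and its proof, p. 31 l. 15–33] -/
theorem reach_reach (c : Fin 3 → R) (phi t psi s : R) :
    shiftZ (shiftU₂ (shiftZ (shiftU₂ c phi) t) psi) s = shiftZ (shiftU₂ c (phi + psi)) (t + s) := by
  rw [shiftU₂_shiftZ, shiftU₂_shiftU₂, shiftZ_shiftZ]

end Moves

/-! ## Good parameters (`HasMonic`) are kept by the moves -/

section Monic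

variable [IsRegularLocalRing R] (c : Fin 3 → R)
  (hgen : Ideal.span {c 0, c 1, c 2} = maximalIdeal R) (hdim : ringKrullDim R = 3)
  {J : Ideal R} {μ : ℕ}

include hgen hdim in
/-- **A monic leading form, expansion-free**: `HasMonic c J μ` (some `in_μ(g)`, `g ∈ J`, has a `Y^μ`
term) yields `g ∈ J` and a unit `f` with `g − f y^μ ∈ F^{(1,N,N)}_{μ+1}` for every `N ≥ 2` (the other
monomials of a degree-`μ` representative involve `u` and have `(1,N,N)`-weight `≥ μ − 1 + N`).
Converse of `MonicTransport.hasMonic_of_sub_mem_weightedIdealW`. [cite: CossartJannsenSaito2020, (12.1)] -/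
theorem HasMonic.exists_sub_mem_weightedIdealW (hmon : HasMonic c J μ) (hJμ : J ≤ maximalIdeal R ^ μ)
    {N : ℕ} (hN : 2 ≤ N) :
    ∃ g ∈ J, ∃ f : R, IsUnit f ∧ g - f * c 0 ^ μ ∈ weightedIdealW c (wN N) (μ + 1) := by
  classical
  obtain ⟨g, hgJ, hg⟩ := hmon
  have hgenr := span_range_eq_of_span_triple c hgen
  have h1 : ∀ i, 0 < (fun _ : Fin 3 => (1 : ℕ)) i := fun _ => Nat.one_pos
  have hw : ∀ i, 0 < wN N i := wN_pos (by omega)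
  have hg1 : g ∈ weightedIdealW c (fun _ => 1) μ := by
    rw [weightedIdealW_one_eq_pow c hgenr]; exact hJμ hgJ
  obtain ⟨F, hF, hFP, hrem⟩ := isInForm_inForm c hgen hdim h1 hg1
  refine ⟨g, hgJ, F.coeff (Finsupp.single 0 μ), ?_, ?_⟩
  · -- the `Y^μ`-coefficient is a unit: its residue is the nonzero coefficient of `in_μ(g)`
    by_contra hnu
    apply hg
    rw [← hFP, coeff_map, residue_eq_zero_iff]
    exact (mem_maximalIdeal _).mpr hnu
  · -- split `F(c)` into the `Y^μ` term and the terms involving `u`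
    have hsplit : g - F.coeff (Finsupp.single 0 μ) * c 0 ^ μ =
        (g - eval c F) + (eval c F - F.coeff (Finsupp.single 0 μ) * c 0 ^ μ) := by ring
    rw [hsplit]
    refine Ideal.add_mem _ ?_ ?_
    · rw [weightedIdealW_one_eq_pow c hgenr] at hrem
      exact pow_maximalIdeal_le_weightedIdealW c hgenr hw (μ + 1) hrem
    · have hev : eval c F = ∑ m ∈ F.support, F.coeff m * monom3 c m := by
        conv_lhs => rw [F.as_sum]
        rw [map_sum]
        exact Finset.sum_congr rfl fun m _ => eval_monomial_eq_monom3 c m (F.coeff m)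
      have hmono : monom3 c (Finsupp.single 0 μ) = c 0 ^ μ := by simp [monom3]
      -- every other monomial of the representative lies in `F^{(1,N,N)}_{μ+1}`
      have hrest : ∀ m ∈ F.support, m ≠ Finsupp.single 0 μ →
          F.coeff m * monom3 c m ∈ weightedIdealW c (wN N) (μ + 1) := by
        intro m hm' hne
        refine Ideal.mul_mem_left _ _ (monomial_mem_weightedIdealW c (wN N) ?_)
        have hwt : Finsupp.weight (fun _ : Fin 3 => (1 : ℕ)) m = μ := hF (mem_support_iff.mp hm')
        rw [weight_one_eq] at hwt
        have h12 : 1 ≤ m 1 + m 2 := by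
          by_contra hlt
          push Not at hlt
          apply hne
          ext i
          fin_cases i
          · simp; omega
          · simp; omega
          · simp; omega
        rw [Finsupp.weight_apply, Finsupp.sum_fintype _ _ (by simp)]
        simp only [Fin.sum_univ_three, wN, Matrix.cons_val_zero, Matrix.cons_val_one,
          Matrix.cons_val_two, Matrix.tail_cons, Matrix.head_cons, smul_eq_mul, mul_one]
        nlinarith
      by_cases hms : Finsupp.single 0 μ ∈ F.support
      · rw [hev, ← Finset.add_sum_erase _ _ hms, hmono, add_sub_cancel_left]
        exact Ideal.sum_mem _ fun m hm =>
          hrest m (Finset.mem_of_mem_erase hm) (Finset.ne_of_mem_erase hm)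
      · have hz : F.coeff (Finsupp.single 0 μ) = 0 := notMem_support_iff.mp hms
        rw [hz, zero_mul, sub_zero, hev]
        exact Ideal.sum_mem _ fun m hm' => hrest m hm' fun h => hms (h ▸ hm')

omit [IsRegularLocalRing R] in
/-- Powers of congruent elements: `x, x′ ∈ F_n`, `x − x′ ∈ F_{n+1}` ⇒ `x^k − x′^k ∈ F_{kn+1}`
(as in `PolygonMinimality`). [folklore] -/
private theorem pow_sub_pow_mem (c : Fin 3 → R) (w : Fin 3 → ℕ) {x x' : R} {n : ℕ}
    (hx : x ∈ weightedIdealW c w n) (hx' : x' ∈ weightedIdealW c w n)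
    (h : x - x' ∈ weightedIdealW c w (n + 1)) (k : ℕ) :
    x ^ k - x' ^ k ∈ weightedIdealW c w (k * n + 1) := by
  induction k with
  | zero => simp
  | succ k ih =>
    have e : x ^ (k + 1) - x' ^ (k + 1) = x * (x ^ k - x' ^ k) + (x - x') * x' ^ k := by ring
    rw [e]
    refine Ideal.add_mem _ ?_ ?_
    · have := weightedIdealW_mul_le c w n (k * n + 1) (Ideal.mul_mem_mul hx ih)
      exact weightedIdealW_antitone c w (by nlinarith) this
    · have := weightedIdealW_mul_le c w (n + 1) (k * n)
        (Ideal.mul_mem_mul h (pow_mem_weightedIdealW c w hx' k))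
      exact weightedIdealW_antitone c w (by nlinarith) this

omit [IsRegularLocalRing R] in
/-- The filtration `F^{(1,N,N)}` of `(y, u₁, u₂ + φu₁)` is that of `(y, u₁, u₂)`, and the one of
`(y + t, u₁, u₂')` CONTAINS it when `t ∈ (u₁, u₂)` (`N ≥ 1`). [folklore] -/
private theorem weightedIdealW_wN_le_reach (c : Fin 3 → R) (phi : R) {t : R}
    (ht : t ∈ Ideal.span ({c 1, c 2} : Set R)) {N : ℕ} (hN : 1 ≤ N) (ρ : ℕ) :
    weightedIdealW c (wN N) ρ ≤ weightedIdealW (shiftZ (shiftU₂ c phi) t) (wN N) ρ := by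
  rw [← weightedIdealW_shiftU₂ c phi (wN N) (le_refl _) ρ]
  set c₁ := shiftU₂ c phi with hc₁
  have ht₁ : t ∈ Ideal.span ({c₁ 1, c₁ 2} : Set R) := by rw [hc₁, span_pair_shiftU₂]; exact ht
  refine weightedIdealW_le_of_forall_apply_mem (shiftZ c₁ t) c₁ (wN N) (fun i => ?_) ρ
  have ht' : t ∈ weightedIdealW (shiftZ c₁ t) (wN N) N := by
    have := span_pair_le_weightedIdealW_wN (c' := shiftZ c₁ t) N
    rw [shiftZ_one, shiftZ_two] at this
    exact this ht₁
  fin_cases i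
  · show c₁ 0 ∈ weightedIdealW (shiftZ c₁ t) (wN N) (wN N 0)
    have h0 := apply_mem_weightedIdealW (shiftZ c₁ t) (wN N) 0
    rw [shiftZ_zero] at h0
    have : c₁ 0 = (c₁ 0 + t) - t := by ring
    rw [this]
    exact Ideal.sub_mem _ h0 (weightedIdealW_antitone _ _ (by show wN N 0 ≤ N; simp [wN]; omega) ht')
  · show c₁ 1 ∈ weightedIdealW (shiftZ c₁ t) (wN N) (wN N 1)
    have h := apply_mem_weightedIdealW (shiftZ c₁ t) (wN N) 1
    rwa [shiftZ_one] at h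
  · show c₁ 2 ∈ weightedIdealW (shiftZ c₁ t) (wN N) (wN N 2)
    have h := apply_mem_weightedIdealW (shiftZ c₁ t) (wN N) 2
    rwa [shiftZ_two] at h

include hgen hdim in
/-- **Good parameters stay good**: if some `in_μ(g)`, `g ∈ J ⊆ 𝔪^μ`, has a `Y^μ` term for
`(y, u₁, u₂)`, the same holds for every reachable system `(y + t, u₁, u₂ + φu₁)`, `t ∈ (u₁, u₂)` (the
translations and well preparations of §10.3 keep "`(x, y, z₁)` are good parameters", Lemma 10.4).
[cite: Cutkosky2009, Lemma 10.4 p. 30 l. 19–22] -/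
theorem hasMonic_reach (hJμ : J ≤ maximalIdeal R ^ μ) (hmon : HasMonic c J μ) (phi : R) {t : R}
    (ht : t ∈ Ideal.span ({c 1, c 2} : Set R)) :
    HasMonic (shiftZ (shiftU₂ c phi) t) J μ := by
  set c' := shiftZ (shiftU₂ c phi) t with hc'
  have hgen' : Ideal.span {c' 0, c' 1, c' 2} = maximalIdeal R := span_triple_reach c hgen phi ht
  obtain ⟨g, hgJ, f, hf, hr⟩ :=
    hmon.exists_sub_mem_weightedIdealW c hgen hdim hJμ (N := μ + 2) (by omega)
  have hle := weightedIdealW_wN_le_reach c phi ht (N := μ + 2) (by omega)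
  refine hasMonic_of_sub_mem_weightedIdealW c' hgen' hdim hJμ hgJ hf (N := μ + 2) (by omega) ?_
  -- `g − f (y + t)^μ = (g − f y^μ) − f ((y+t)^μ − y^μ)`
  have ht' : t ∈ weightedIdealW c' (wN (μ + 2)) (μ + 2) := by
    have := span_pair_le_weightedIdealW_wN (c' := c') (μ + 2)
    rw [hc', shiftZ_one, shiftZ_two, span_pair_shiftU₂] at this
    exact this ht
  have hy' : c' 0 ∈ weightedIdealW c' (wN (μ + 2)) 1 := apply_mem_weightedIdealW c' (wN (μ + 2)) 0
  have hy : c 0 ∈ weightedIdealW c' (wN (μ + 2)) 1 := by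
    have : c 0 = c' 0 - t := by rw [hc', shiftZ_zero, shiftU₂_zero]; ring
    rw [this]
    exact Ideal.sub_mem _ hy' (weightedIdealW_antitone _ _ (by omega) ht')
  have hdiff : c' 0 - c 0 ∈ weightedIdealW c' (wN (μ + 2)) (1 + 1) := by
    have : c' 0 - c 0 = t := by rw [hc', shiftZ_zero, shiftU₂_zero]; ring
    rw [this]
    exact weightedIdealW_antitone _ _ (by omega) ht'
  have hpow := pow_sub_pow_mem c' (wN (μ + 2)) hy' hy hdiff μ
  rw [mul_one] at hpow
  have hsplit : g - f * c' 0 ^ μ = (g - f * c 0 ^ μ) - f * (c' 0 ^ μ - c 0 ^ μ) := by ring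
  rw [hsplit]
  exact Ideal.sub_mem _ (hle _ hr) (Ideal.mul_mem_left _ _ hpow)

end Monic

namespace Cutkosky2009

/-! ## Well prepared systems; the lowest point of the polygon on a line -/

section Defs

/-- **"`(I; x, y, z)` is well prepared"** — "If all vertices `(a, b)` of `|Δ|` are prepared" — in the
tree's form: prepared at every vertex of every abscissa (`BoundedPreparation.PreparedUpTo` for all
bounds `B`). [cite: Cutkosky2009, §10.2 p. 29 l. 13–16] -/
def WellPrepared [IsRegularLocalRing R] (c : Fin 3 → R) (J : Ideal R) (μ : ℕ) : Prop :=
  ∀ B, PreparedUpTo c J μ B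

/-- **The ordinate of the lowest point of the polygon on the line `p₁ x₁ + p₂ x₂ = w₀`** (scaled; `0` if
the line misses the Newton points): Definition 10.8 (2)(c)'s "`(c, d)` is the lowest point on the line
through `(α, β)` with slope `−ε` in `|Δ(I; x, y, z)|`" is `lowOrdS c J μ 1 n (αs + n βs)` for `ε = 1/n`,
and Cutkosky's `δ` is `lowOrdS c J μ 1 1 δs = gammaMinusS`. [cite: Cutkosky2009, Def. 10.8 (2)(c), p. 31 l. 12–14] -/
def lowOrdS (c : Fin 3 → R) (J : Ideal R) (μ : ℕ) (p₁ p₂ w₀ : ℕ) : ℕ :=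
  sInf (spt₂ μ '' {e | e ∈ pts c J μ ∧ p₁ * spt₁ μ e + p₂ * spt₂ μ e = w₀})

variable {c : Fin 3 → R} {J : Ideal R} {μ : ℕ}

/-- The lowest point of the polygon on a line meeting the Newton points is attained ("`(c, d)` is the
lowest point on the line …"). [cite: Cutkosky2009, Def. 10.8 (2)(c), p. 31 l. 12–14] -/
theorem exists_pts_lowOrdS {p₁ p₂ w₀ : ℕ} {e₀ : Fin 3 →₀ ℕ} (he₀ : e₀ ∈ pts c J μ)
    (h₀ : p₁ * spt₁ μ e₀ + p₂ * spt₂ μ e₀ = w₀) :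
    ∃ e ∈ pts c J μ, p₁ * spt₁ μ e + p₂ * spt₂ μ e = w₀ ∧ spt₂ μ e = lowOrdS c J μ p₁ p₂ w₀ := by
  have hne : ({e | e ∈ pts c J μ ∧ p₁ * spt₁ μ e + p₂ * spt₂ μ e = w₀}).Nonempty := ⟨e₀, he₀, h₀⟩
  have := Nat.sInf_mem (hne.image (spt₂ μ))
  obtain ⟨e, ⟨he, h⟩, h2⟩ := (Set.mem_image _ _ _).mp this
  exact ⟨e, he, h, h2⟩

/-- `lowOrdS` is a lower bound for the ordinates of the Newton points on the line.
[cite: Cutkosky2009, Def. 10.8 (2)(c), p. 31 l. 12–14] -/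
theorem lowOrdS_le {p₁ p₂ w₀ : ℕ} {e : Fin 3 →₀ ℕ} (he : e ∈ pts c J μ)
    (h : p₁ * spt₁ μ e + p₂ * spt₂ μ e = w₀) : lowOrdS c J μ p₁ p₂ w₀ ≤ spt₂ μ e :=
  Nat.sInf_le ⟨e, ⟨he, h⟩, rfl⟩

/-- Cutkosky's `δ` (tree `γ⁻s`) is the lowest ordinate on the `δ`-line `x₁ + x₂ = δs`. [cite: Cutkosky2009, §10.1 p. 28 l. 31–34] -/
theorem lowOrdS_one_one_deltaS : lowOrdS c J μ 1 1 (deltaS c J μ) = gammaMinusS c J μ := by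
  unfold lowOrdS gammaMinusS
  congr 1
  ext x
  simp only [Set.mem_image, Set.mem_setOf_eq, one_mul]

/-- The vertex `v = (α, β)` lies on "the line through `(α, β)` with slope `−1/n`" `x₁ + n x₂ = αs + nβs`,
so the lowest ordinate there is `≤ βs`. [cite: Cutkosky2009, Def. 10.8 (2)(c), p. 31 l. 12–14] -/
theorem lowOrdS_slopeLine_le_betaS (hne : (pts c J μ).Nonempty) (n : ℕ) :
    lowOrdS c J μ 1 n (alphaS c J μ + n * betaS c J μ) ≤ betaS c J μ := by
  obtain ⟨e, he, h1, h2⟩ := exists_pts_v hne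
  rw [← h2]
  exact lowOrdS_le he (by rw [h1, h2, one_mul])

end Defs

/-! ## Well prepared ⇒ prepared at `v`, `w⁻`, `w⁺`; Cutkosky's `1/ε = n` on the Newton points -/

section Basic

variable [IsRegularLocalRing R] (c : Fin 3 → R)
  (hgen : Ideal.span {c 0, c 1, c 2} = maximalIdeal R) (hdim : ringKrullDim R = 3)
  {J : Ideal R} {μ : ℕ}

include hgen hdim in
/-- A well prepared system is `v`-prepared. [cite: Cutkosky2009, §10.2 p. 29 l. 13–16] -/
theorem WellPrepared.vPrepared (hwp : WellPrepared c J μ) (hJμ : J ≤ maximalIdeal R ^ μ)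
    (hne : (pts c J μ).Nonempty) : VPrepared c J μ :=
  vPrepared_of_preparedUpTo c hgen hdim hJμ hne le_rfl (hwp _)

include hgen hdim in
/-- A well prepared system is prepared at `w⁻` (Cutkosky's vertex `(γ − δ, δ)`).
[cite: Cutkosky2009, §10.2 p. 29 l. 13–16] -/
theorem WellPrepared.wMinusPrepared (hwp : WellPrepared c J μ) (hJμ : J ≤ maximalIdeal R ^ μ)
    (hne : (pts c J μ).Nonempty) : WMinusPrepared c J μ :=
  wMinusPrepared_of_preparedUpTo c hgen hdim hJμ hne le_rfl (hwp _)

include hgen hdim in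
/-- **Bounded preparedness includes preparedness at `w⁺`** (the upper vertex of the first face of
slope `−1` is realised, alone on the canonical line `(N+1) x₁ + N x₂`, `N = δs + 1`, and has abscissa
`δs − γ⁺s ≤ B`). [cite: CossartJannsenSaito2020, Prop. 14.3 (b)] -/
theorem wPlusPrepared_of_preparedUpTo (hJμ : J ≤ maximalIdeal R ^ μ) (hne : (pts c J μ).Nonempty)
    {B : ℕ} (hB : deltaS c J μ - gammaPlusS c J μ ≤ B) (h : PreparedUpTo c J μ B) :
    WPlusPrepared c J μ := by
  intro v₁ v₂ lam hv₁ hv₂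
  obtain ⟨e, he, hsum, he2⟩ := exists_pts_wPlus hne
  have hδ : μ.factorial ≤ deltaS c J μ := by
    have := factorial_le_spt_add c hgen hdim hJμ he; omega
  have hγδ : gammaPlusS c J μ ≤ deltaS c J μ := gammaPlusS_le_deltaS hne
  have hL := Nat.factorial_pos μ
  have hpos : 0 < wPlusLevel c J μ := by
    rw [wPlusLevel, tiltPN]
    have : 2 * deltaS c J μ ≤ (deltaS c J μ + 1 + 1) * deltaS c J μ :=
      Nat.mul_le_mul_right _ (by omega)
    omega
  have he1 : spt₁ μ e = μ.factorial * v₁ := by omega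
  refine h (wPlusLevel c J μ) (tiltPN c J μ + 1) (tiltPN c J μ) hpos (by omega)
    (by rw [tiltPN]; omega) forall_pts_wPlusWeight v₁ v₂ (by rw [← he1]; omega) ?_
    ⟨e, he, he1, by rw [he2, hv₂]⟩ ?_ lam
  · rw [wPlusLevel, hv₁, hv₂, tiltPN]
    have : (deltaS c J μ + 1 + 1) * (μ.factorial * v₁ + μ.factorial * v₂) =
        μ.factorial * ((deltaS c J μ + 1 + 1) * v₁ + (deltaS c J μ + 1) * v₂) + μ.factorial * v₂ := by
      ring
    rw [this, Nat.add_sub_cancel]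
  · intro x hx hline
    obtain ⟨h1, h2⟩ := eq_wPlus_of_wPlusLine hx hline
    exact ⟨by omega, by rw [h2, hv₂]⟩

include hgen hdim in
/-- A well prepared system is prepared at `w⁺`. [cite: Cutkosky2009, §10.2 p. 29 l. 13–16] -/
theorem WellPrepared.wPlusPrepared (hwp : WellPrepared c J μ) (hJμ : J ≤ maximalIdeal R ^ μ)
    (hne : (pts c J μ).Nonempty) : WPlusPrepared c J μ :=
  wPlusPrepared_of_preparedUpTo c hgen hdim hJμ hne le_rfl (hwp _)

/-! ### The polygon of a well prepared reachable system is the smaller one -/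

include hgen hdim in
/-- **A well prepared reachable system has the smaller polygon**: if `(y + t, u₁, u₂ + φu₁)`,
`t ∈ (u₁, u₂)`, is well prepared (and `J ⊆ 𝔪^μ` has a `Y^μ`-corner), every positive half-plane
containing the polygon of the translated system `(y, u₁, u₂ + φu₁)` contains its polygon — Hironaka's
minimality (4.8) (`PolygonMinimality`) applied to the change `y + t ↦ y`.
[cite: Hironaka1967, Thm. (4.8)] [cite: Cutkosky2009, Lemma 10.7 p. 30 l. 67–69] -/
theorem forall_pts_reach_of_wellPrepared (hJμ : J ≤ maximalIdeal R ^ μ) (hmon : HasMonic c J μ)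
    (phi : R) {t : R} (ht : t ∈ Ideal.span ({c 1, c 2} : Set R))
    (hwp' : WellPrepared (shiftZ (shiftU₂ c phi) t) J μ) {w₀ p₁ p₂ : ℕ} (hp₁ : 0 < p₁)
    (hp₂ : 0 < p₂) (hS : ∀ e ∈ pts (shiftU₂ c phi) J μ, w₀ ≤ p₁ * spt₁ μ e + p₂ * spt₂ μ e) :
    ∀ e ∈ pts (shiftZ (shiftU₂ c phi) t) J μ, w₀ ≤ p₁ * spt₁ μ e + p₂ * spt₂ μ e := by
  set c' := shiftZ (shiftU₂ c phi) t with hc'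
  have hgen' : Ideal.span {c' 0, c' 1, c' 2} = maximalIdeal R := span_triple_reach c hgen phi ht
  have hmon' : HasMonic c' J μ := hasMonic_reach c hgen hdim hJμ hmon phi ht
  have ht' : -t ∈ Ideal.span ({c' 1, c' 2} : Set R) := by
    rw [hc', span_pair_shiftZ, span_pair_shiftU₂]; exact Submodule.neg_mem _ ht
  have hback : shiftZ c' (-t) = shiftU₂ c phi := by rw [hc', shiftZ_shiftZ_neg]
  refine forall_pts_of_forall_pts_shiftZ_of_forall_preparedUpTo c' hgen' hdim hJμ hmon' hwp' ht'
    hp₁ hp₂ ?_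
  rw [hback]; exact hS

/-! ### Lemma 10.7: `α, β, γ` are unchanged by a translation and a subsequent well preparation -/

include hgen hdim in
/-- **The upper `δ`-vertex `w⁺` persists under a re-preparation** (companion of
`PolygonMinimality.deltaS_gammaMinusS_shiftZ_eq_of_wMinusPrepared`): if `(y, u)` is prepared at
`w⁺ = (δ − γ⁺, γ⁺)` (`FacePreparationPlus.WPlusPrepared`), `J ⊆ 𝔪^μ` has a `Y^μ`-corner and the polygon
is non-empty, then every change `y ↦ y + t`, `t ∈ (u₁, u₂)`, that shrinks the polygon keeps `w⁺`,
hence `δs` and `γ⁺s` (the tree form behind "`γ_{x,y₁,z₁}(I) = γ_{xyz}(I)`" of Lemma 10.7).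
[cite: Cutkosky2009, Lemma 10.7 p. 30 l. 67–69] [cite: Hironaka1967, Thm. (4.8)] -/
theorem deltaS_gammaPlusS_shiftZ_eq_of_wPlusPrepared (hJμ : J ≤ maximalIdeal R ^ μ)
    (hmon : HasMonic c J μ) (hne : (pts c J μ).Nonempty) (hwprep : WPlusPrepared c J μ) {t : R}
    (ht : t ∈ Ideal.span ({c 1, c 2} : Set R))
    (hsub : ∀ (w₀ q₁ q₂ : ℕ), 0 < w₀ → 0 < q₁ → 0 < q₂ →
      (∀ e ∈ pts c J μ, w₀ ≤ q₁ * spt₁ μ e + q₂ * spt₂ μ e) →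
      ∀ e ∈ pts (shiftZ c t) J μ, w₀ ≤ q₁ * spt₁ μ e + q₂ * spt₂ μ e) :
    deltaS (shiftZ c t) J μ = deltaS c J μ ∧ gammaPlusS (shiftZ c t) J μ = gammaPlusS c J μ := by
  obtain ⟨ev, hev, hev12, hev2⟩ := exists_pts_wPlus hne
  have hL := Nat.factorial_pos μ
  have hδL : μ.factorial ≤ deltaS c J μ := by
    have := factorial_le_spt_add c hgen hdim hJμ hev; omega
  have hγδ : gammaPlusS c J μ ≤ deltaS c J μ := gammaPlusS_le_deltaS hne
  obtain ⟨d, hd⟩ : ∃ d, deltaS c J μ = gammaPlusS c J μ + d := ⟨_, (Nat.add_sub_cancel' hγδ).symm⟩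
  have hev1 : spt₁ μ ev = d := by omega
  set N := tiltPN c J μ with hN
  have htp : 0 < N := Nat.succ_pos _
  have hwl : wPlusLevel c J μ = (N + 1) * d + N * gammaPlusS c J μ := by
    rw [wPlusLevel, ← hN, hd]
    have : (N + 1) * (gammaPlusS c J μ + d) = (N + 1) * d + N * gammaPlusS c J μ + gammaPlusS c J μ := by
      ring
    rw [this, Nat.add_sub_cancel]
  have hlev : (N + 1) * spt₁ μ ev + N * spt₂ μ ev = wPlusLevel c J μ := by
    rw [hwl, hev1, hev2]
  have hS : ∀ e ∈ pts c J μ, (N + 1) * spt₁ μ ev + N * spt₂ μ ev ≤ (N + 1) * spt₁ μ e + N * spt₂ μ e := by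
    intro e he; rw [hlev]; exact forall_pts_wPlusWeight e he
  have huniq : ∀ e ∈ pts c J μ, (N + 1) * spt₁ μ e + N * spt₂ μ e = (N + 1) * spt₁ μ ev + N * spt₂ μ ev →
      spt₁ μ e = spt₁ μ ev ∧ spt₂ μ e = spt₂ μ ev := by
    intro e he h
    rw [hlev] at h
    obtain ⟨h1, h2⟩ := eq_wPlus_of_wPlusLine he h
    constructor <;> omega
  have hns : ∀ (v₁ v₂ : ℕ) (lam : ResidueField R), spt₁ μ ev = μ.factorial * v₁ →
      spt₂ μ ev = μ.factorial * v₂ →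
      ¬ IsSolvableAt c J (levelWeight μ ((N + 1) * spt₁ μ ev + N * spt₂ μ ev) (N + 1) N)
        (((N + 1) * spt₁ μ ev + N * spt₂ μ ev) * μ) μ (vexp v₁ v₂) lam := by
    intro v₁ v₂ lam h1 h2
    rw [hlev]
    exact hwprep v₁ v₂ lam (by rw [← hev2, ← h1]; omega) (by rw [← hev2, h2])
  obtain ⟨⟨e', he', he'1, he'2⟩, -⟩ := vertex_mem_pts_shiftZ_of_vertex c hgen hdim hJμ hmon ht
    (by omega : 0 < N + 1) htp hev hS huniq hns hsub
  have hne' : (pts (shiftZ c t) J μ).Nonempty := ⟨e', he'⟩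
  have he'12 : spt₁ μ e' + spt₂ μ e' = deltaS c J μ := by rw [he'1, he'2, hev12]
  have hδpos : 0 < deltaS c J μ := by omega
  -- `δs` is unchanged
  have hδ : deltaS (shiftZ c t) J μ = deltaS c J μ := by
    apply le_antisymm
    · rw [← he'12]; exact deltaS_le he'
    · obtain ⟨e, he, h⟩ := exists_pts_deltaS hne'
      rw [← h]
      have := hsub (deltaS c J μ) 1 1 hδpos Nat.one_pos Nat.one_pos
        (fun x hx => by rw [one_mul, one_mul]; exact deltaS_le hx) e he
      rw [one_mul, one_mul] at this
      exact this
  refine ⟨hδ, le_antisymm ?_ ?_⟩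
  · obtain ⟨e, he, h1, h2⟩ := exists_pts_wPlus hne'
    rw [← h2]
    have hwpos : 0 < wPlusLevel c J μ := by
      rw [hwl]
      have : gammaPlusS c J μ + d ≤ (N + 1) * d + N * gammaPlusS c J μ := by nlinarith
      omega
    have := hsub (wPlusLevel c J μ) (N + 1) N hwpos (by omega) htp
      (fun x hx => forall_pts_wPlusWeight x hx) e he
    rw [hδ] at h1
    have h1' : spt₁ μ e + spt₂ μ e = gammaPlusS c J μ + d := by rw [h1, hd]
    have key : wPlusLevel c J μ = N * (gammaPlusS c J μ + d) + d := by rw [hwl]; ring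
    have hsplit : (N + 1) * spt₁ μ e + N * spt₂ μ e = N * (spt₁ μ e + spt₂ μ e) + spt₁ μ e := by ring
    rw [key, hsplit, h1'] at this
    omega
  · rw [← hev2, ← he'2]; exact le_gammaPlusS he' (by rw [hδ]; exact he'12)

include hgen hdim in
/-- **The vertex `v` of a translated and re-prepared system** (under Lemma 10.7's hypotheses): some
Newton point of `(y + t, u₁, u₂ + φu₁)` sits at `(αs, βs)` of `c` — in particular its polygon is
non-empty. [cite: Cutkosky2009, Lemma 10.7 p. 30 l. 67–69] -/
theorem exists_pts_reach_v (hJμ : J ≤ maximalIdeal R ^ μ) (hmon : HasMonic c J μ)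
    (hne : (pts c J μ).Nonempty) (hwp : WellPrepared c J μ) (phi : R) {t : R}
    (ht : t ∈ Ideal.span ({c 1, c 2} : Set R)) (hwp' : WellPrepared (shiftZ (shiftU₂ c phi) t) J μ) :
    ∃ e ∈ pts (shiftZ (shiftU₂ c phi) t) J μ, spt₁ μ e = alphaS c J μ ∧ spt₂ μ e = betaS c J μ := by
  set c₁ := shiftU₂ c phi with hc₁
  have hgen₁ : Ideal.span {c₁ 0, c₁ 1, c₁ 2} = maximalIdeal R := by
    rw [hc₁, span_triple_shiftU₂]; exact hgen
  have hne₁ : (pts c₁ J μ).Nonempty := pts_shiftU₂_nonempty c hgen hdim phi hJμ hne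
  have hmon₁ : HasMonic c₁ J μ := by
    have := hasMonic_reach c hgen hdim hJμ hmon phi (t := 0) (Ideal.zero_mem _)
    rwa [shiftZ_zero_eq] at this
  have hv₁ : VPrepared c₁ J μ :=
    (vPrepared_shiftU₂_iff c hgen hdim phi hJμ hne).mpr (hwp.vPrepared c hgen hdim hJμ hne)
  have ht₁ : t ∈ Ideal.span ({c₁ 1, c₁ 2} : Set R) := by rw [hc₁, span_pair_shiftU₂]; exact ht
  have hsub : ∀ (w₀ q₁ q₂ : ℕ), 0 < w₀ → 0 < q₁ → 0 < q₂ →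
      (∀ e ∈ pts c₁ J μ, w₀ ≤ q₁ * spt₁ μ e + q₂ * spt₂ μ e) →
      ∀ e ∈ pts (shiftZ c₁ t) J μ, w₀ ≤ q₁ * spt₁ μ e + q₂ * spt₂ μ e :=
    fun w₀ q₁ q₂ _ hq₁ hq₂ hS => forall_pts_reach_of_wellPrepared c hgen hdim hJμ hmon phi ht hwp' hq₁ hq₂ hS
  obtain ⟨hα₁, hβ₁⟩ := alphaS_shiftU₂_and_betaS_shiftU₂ c hgen hdim phi hJμ hne
  obtain ⟨ev, hev, hev1, hev2⟩ := exists_pts_v hne₁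
  have hL := Nat.factorial_pos μ
  have hsteep : 0 < steepN c₁ J μ := Nat.succ_pos _
  have hlev : steepN c₁ J μ * spt₁ μ ev + 1 * spt₂ μ ev = vLevel c₁ J μ := by
    rw [hev1, hev2, vLevel, one_mul]
  have hS : ∀ e ∈ pts c₁ J μ, steepN c₁ J μ * spt₁ μ ev + 1 * spt₂ μ ev ≤
      steepN c₁ J μ * spt₁ μ e + 1 * spt₂ μ e := by
    intro e he; rw [hlev]; exact forall_pts_vWeight e he
  have huniq : ∀ e ∈ pts c₁ J μ, steepN c₁ J μ * spt₁ μ e + 1 * spt₂ μ e =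
      steepN c₁ J μ * spt₁ μ ev + 1 * spt₂ μ ev → spt₁ μ e = spt₁ μ ev ∧ spt₂ μ e = spt₂ μ ev := by
    intro e he h
    rw [hlev] at h
    rw [hev1, hev2]
    exact eq_v_of_vLine he h
  have hns : ∀ (v₁ v₂ : ℕ) (lam : ResidueField R), spt₁ μ ev = μ.factorial * v₁ →
      spt₂ μ ev = μ.factorial * v₂ →
      ¬ IsSolvableAt c₁ J (levelWeight μ (steepN c₁ J μ * spt₁ μ ev + 1 * spt₂ μ ev) (steepN c₁ J μ) 1)
        ((steepN c₁ J μ * spt₁ μ ev + 1 * spt₂ μ ev) * μ) μ (vexp v₁ v₂) lam := by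
    intro v₁ v₂ lam h1 h2
    rw [hlev]
    exact hv₁ v₁ v₂ lam (by rw [← hev1, h1]) (by rw [← hev2, h2])
  obtain ⟨⟨e', he', he'1, he'2⟩, -⟩ := vertex_mem_pts_shiftZ_of_vertex c₁ hgen₁ hdim hJμ hmon₁ ht₁
    hsteep Nat.one_pos hev hS huniq hns hsub
  exact ⟨e', he', by rw [he'1, hev1, hα₁], by rw [he'2, hev2, hβ₁]⟩

include hgen hdim in
/-- **Cutkosky 2009, Lemma 10.7, in the tree's form (for every translation and every subsequent well
preparation).** Let `(y, u₁, u₂)` be well prepared, `J ⊆ 𝔪^μ` with a `Y^μ`-corner (good parameters)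
and a non-empty polygon. Then for every `φ ∈ R` and every `t ∈ (u₁, u₂)` such that
`(y + t, u₁, u₂ + φu₁)` is again well prepared, "`α_{x,y₁,z₁}(I) = α_{xyz}(I)`, `β_{x,y₁,z₁}(I) = β_{xyz}(I)`
and `γ_{x,y₁,z₁}(I) = γ_{xyz}(I)`" — the tree's `αs, βs, δs` (and `γ⁺s`) are unchanged. Proof: the
translation keeps `αs, βs, δs, γ⁺s`, `v`- and `w⁺`-preparedness (`PolygonShear`, `PolygonTranslation`);
the well prepared system has the smaller polygon (minimality), in which the non-solvable vertices `v`
and `w⁺` persist (`PolygonMinimality`). [cite: Cutkosky2009, Lemma 10.7 p. 30 l. 67–69] -/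
theorem alphaS_betaS_deltaS_reach_eq (hJμ : J ≤ maximalIdeal R ^ μ) (hmon : HasMonic c J μ)
    (hne : (pts c J μ).Nonempty) (hwp : WellPrepared c J μ) (phi : R) {t : R}
    (ht : t ∈ Ideal.span ({c 1, c 2} : Set R)) (hwp' : WellPrepared (shiftZ (shiftU₂ c phi) t) J μ) :
    alphaS (shiftZ (shiftU₂ c phi) t) J μ = alphaS c J μ ∧
    betaS (shiftZ (shiftU₂ c phi) t) J μ = betaS c J μ ∧
    deltaS (shiftZ (shiftU₂ c phi) t) J μ = deltaS c J μ ∧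
    gammaPlusS (shiftZ (shiftU₂ c phi) t) J μ = gammaPlusS c J μ := by
  set c₁ := shiftU₂ c phi with hc₁
  have hgen₁ : Ideal.span {c₁ 0, c₁ 1, c₁ 2} = maximalIdeal R := by
    rw [hc₁, span_triple_shiftU₂]; exact hgen
  have hne₁ : (pts c₁ J μ).Nonempty := pts_shiftU₂_nonempty c hgen hdim phi hJμ hne
  have hmon₁ : HasMonic c₁ J μ := by
    have := hasMonic_reach c hgen hdim hJμ hmon phi (t := 0) (Ideal.zero_mem _)
    rwa [shiftZ_zero_eq] at this
  have hv₁ : VPrepared c₁ J μ :=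
    (vPrepared_shiftU₂_iff c hgen hdim phi hJμ hne).mpr (hwp.vPrepared c hgen hdim hJμ hne)
  have hwplus₁ : WPlusPrepared c₁ J μ :=
    (wPlusPrepared_shiftU₂_iff c hgen hdim phi hJμ hne).mpr (hwp.wPlusPrepared c hgen hdim hJμ hne)
  have ht₁ : t ∈ Ideal.span ({c₁ 1, c₁ 2} : Set R) := by rw [hc₁, span_pair_shiftU₂]; exact ht
  have hsub : ∀ (w₀ q₁ q₂ : ℕ), 0 < w₀ → 0 < q₁ → 0 < q₂ →
      (∀ e ∈ pts c₁ J μ, w₀ ≤ q₁ * spt₁ μ e + q₂ * spt₂ μ e) →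
      ∀ e ∈ pts (shiftZ c₁ t) J μ, w₀ ≤ q₁ * spt₁ μ e + q₂ * spt₂ μ e :=
    fun w₀ q₁ q₂ _ hq₁ hq₂ hS => forall_pts_reach_of_wellPrepared c hgen hdim hJμ hmon phi ht hwp' hq₁ hq₂ hS
  obtain ⟨hα, hβ⟩ := alphaS_betaS_shiftZ_eq_of_vPrepared c₁ hgen₁ hdim hJμ hmon₁ hne₁ hv₁ ht₁ hsub
  obtain ⟨hδ, hγ⟩ :=
    deltaS_gammaPlusS_shiftZ_eq_of_wPlusPrepared c₁ hgen₁ hdim hJμ hmon₁ hne₁ hwplus₁ ht₁ hsub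
  exact ⟨hα.trans (alphaS_shiftU₂ c hgen hdim phi hJμ hne), hβ.trans (betaS_shiftU₂ c hgen hdim phi hJμ hne),
    hδ.trans (deltaS_shiftU₂ c hgen hdim phi hJμ hne), hγ.trans (gammaPlusS_shiftU₂ c hgen hdim phi hJμ hne)⟩

include hgen hdim in
/-- **For `n ≥ 2`, also Cutkosky's `δ` (tree `γ⁻s`) is unchanged** by the translation `y₁ = y − ηxⁿ`
(`u₁^k ∣ φ`, `k ≥ 1`) and a subsequent well preparation: `w⁻` survives the translation together with
its preparedness (`PolygonTranslation`) and then the re-preparation (`PolygonMinimality`). (For `n = 1`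
this fails; Definition 10.8 (1) / Lemma 10.9 maximise `δ` instead.)
[cite: Cutkosky2009, Lemma 10.6 / 10.7 p. 30 l. 59–69; Def. 10.8 (1)] -/
theorem gammaMinusS_reach_eq_of_pow_dvd (hJμ : J ≤ maximalIdeal R ^ μ) (hmon : HasMonic c J μ)
    (hne : (pts c J μ).Nonempty) (hwp : WellPrepared c J μ) {phi : R} {k : ℕ} (hk : 1 ≤ k)
    (hphi : c 1 ^ k ∣ phi) {t : R} (ht : t ∈ Ideal.span ({c 1, c 2} : Set R))
    (hwp' : WellPrepared (shiftZ (shiftU₂ c phi) t) J μ) :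
    gammaMinusS (shiftZ (shiftU₂ c phi) t) J μ = gammaMinusS c J μ := by
  set c₁ := shiftU₂ c phi with hc₁
  have hgen₁ : Ideal.span {c₁ 0, c₁ 1, c₁ 2} = maximalIdeal R := by
    rw [hc₁, span_triple_shiftU₂]; exact hgen
  have hne₁ : (pts c₁ J μ).Nonempty := pts_shiftU₂_nonempty c hgen hdim phi hJμ hne
  have hmon₁ : HasMonic c₁ J μ := by
    have := hasMonic_reach c hgen hdim hJμ hmon phi (t := 0) (Ideal.zero_mem _)
    rwa [shiftZ_zero_eq] at this
  have hw₁ : WMinusPrepared c₁ J μ :=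
    (wMinusPrepared_shiftU₂_iff_of_pow_dvd c hgen hdim hphi hk hJμ hne).mpr
      (hwp.wMinusPrepared c hgen hdim hJμ hne)
  have ht₁ : t ∈ Ideal.span ({c₁ 1, c₁ 2} : Set R) := by rw [hc₁, span_pair_shiftU₂]; exact ht
  have hsub : ∀ (w₀ q₁ q₂ : ℕ), 0 < w₀ → 0 < q₁ → 0 < q₂ →
      (∀ e ∈ pts c₁ J μ, w₀ ≤ q₁ * spt₁ μ e + q₂ * spt₂ μ e) →
      ∀ e ∈ pts (shiftZ c₁ t) J μ, w₀ ≤ q₁ * spt₁ μ e + q₂ * spt₂ μ e :=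
    fun w₀ q₁ q₂ _ hq₁ hq₂ hS => forall_pts_reach_of_wellPrepared c hgen hdim hJμ hmon phi ht hwp' hq₁ hq₂ hS
  obtain ⟨-, hγ⟩ := deltaS_gammaMinusS_shiftZ_eq_of_wMinusPrepared c₁ hgen₁ hdim hJμ hmon₁ hne₁ hw₁ ht₁ hsub
  exact hγ.trans (gammaMinusS_shiftU₂_of_pow_dvd c hgen hdim hphi hk hJμ hne)

omit [IsRegularLocalRing R] in
/-- **`1/ε = n` read on the Newton points** (`n ≥ 1`, non-empty polygon): Cutkosky's `ε` — "the
absolute value of the largest slope of a line through `(α, β)` such that no points of `|Δ|` lie below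
it" — equals `1/n` iff the polygon lies in the half-plane `x₁ + n x₂ ≥ αs + n βs` (no point below the
line of slope `−1/n` through `v`) and some point of it other than `v`, i.e. below the level `βs`, lies
ON that line. [cite: Cutkosky2009, §10.1 p. 28 l. 35–37; Def. 10.8 (2)(c) p. 31 l. 6–14] -/
theorem invEpsCu_eq_natCast_iff (hne : (pts c J μ).Nonempty) {n : ℕ} (hn : 1 ≤ n) :
    invEpsCu c J μ = ((n : ℚ) : WithTop ℚ) ↔
      (∀ e ∈ pts c J μ, alphaS c J μ + n * betaS c J μ ≤ spt₁ μ e + n * spt₂ μ e) ∧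
      lowOrdS c J μ 1 n (alphaS c J μ + n * betaS c J μ) < betaS c J μ := by
  have hnq : (0 : ℚ) < n := by exact_mod_cast hn
  -- `invEpsCu = n ⟺ epsCu = 1/n`
  have key : invEpsCu c J μ = ((n : ℚ) : WithTop ℚ) ↔ epsCu c J μ = (n : ℚ)⁻¹ := by
    unfold invEpsCu
    split_ifs with h0
    · constructor
      · intro h; exact absurd h WithTop.top_ne_coe
      · intro h; rw [h0] at h; exact absurd h.symm (inv_ne_zero hnq.ne')
    · rw [WithTop.coe_eq_coe]
      constructor
      · intro h; rw [← h, inv_inv]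
      · intro h; rw [h, inv_inv]
  rw [key]
  constructor
  · intro hε
    have hpos : 0 < epsCu c J μ := by rw [hε]; exact inv_pos.mpr hnq
    refine ⟨fun e he => ?_, ?_⟩
    · have h := sub_le_epsCu_mul he
      rw [hε] at h
      have hα : (alphaS c J μ : ℚ) ≤ spt₁ μ e := by exact_mod_cast alphaS_le he
      have h' : (n : ℚ) * ((betaS c J μ : ℚ) - spt₂ μ e) ≤ (spt₁ μ e : ℚ) - alphaS c J μ := by
        have := mul_le_mul_of_nonneg_left h hnq.le
        rwa [← mul_assoc, mul_inv_cancel₀ hnq.ne', one_mul] at this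
      have : ((alphaS c J μ + n * betaS c J μ : ℕ) : ℚ) ≤ ((spt₁ μ e + n * spt₂ μ e : ℕ) : ℚ) := by
        push_cast; linarith
      exact_mod_cast this
    · rcases epsCu_eq_zero_or_exists (c := c) (J := J) (μ := μ) with h0 | ⟨e, he, hslope⟩
      · rw [h0] at hpos; exact absurd hpos (lt_irrefl _)
      · have h1 : (alphaS c J μ : ℚ) < spt₁ μ e := by
          exact_mod_cast alphaS_lt_spt₁_of_mem_lowPts he
        rw [hε] at hslope
        unfold slopeOf at hslope
        rw [div_eq_iff (by linarith)] at hslope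
        have h' : (n : ℚ) * ((betaS c J μ : ℚ) - spt₂ μ e) = (spt₁ μ e : ℚ) - alphaS c J μ := by
          rw [hslope, ← mul_assoc, mul_inv_cancel₀ hnq.ne', one_mul]
        have hlineQ : ((1 * spt₁ μ e + n * spt₂ μ e : ℕ) : ℚ) =
            ((alphaS c J μ + n * betaS c J μ : ℕ) : ℚ) := by
          push_cast; linarith
        have hline : 1 * spt₁ μ e + n * spt₂ μ e = alphaS c J μ + n * betaS c J μ := by
          exact_mod_cast hlineQ
        exact lt_of_le_of_lt (lowOrdS_le he.1 hline) he.2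
  · rintro ⟨hhalf, hlow⟩
    obtain ⟨ev, hev, hev1, hev2⟩ := exists_pts_v hne
    obtain ⟨e₀, he₀, hl₀, hb₀⟩ := exists_pts_lowOrdS (c := c) (J := J) (μ := μ) (p₁ := 1) (p₂ := n)
      (w₀ := alphaS c J μ + n * betaS c J μ) hev (by rw [hev1, hev2, one_mul])
    have hlow₀ : spt₂ μ e₀ < betaS c J μ := by rw [hb₀]; exact hlow
    have hmem₀ : e₀ ∈ lowPts c J μ := ⟨he₀, hlow₀⟩
    have h1₀ : (alphaS c J μ : ℚ) < spt₁ μ e₀ := by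
      exact_mod_cast alphaS_lt_spt₁_of_mem_lowPts hmem₀
    have hl₀Q : ((spt₁ μ e₀ : ℚ)) + n * spt₂ μ e₀ = alphaS c J μ + n * betaS c J μ := by
      rw [one_mul] at hl₀; exact_mod_cast hl₀
    have hslope₀ : slopeOf c J μ e₀ = (n : ℚ)⁻¹ := by
      unfold slopeOf
      rw [div_eq_iff (by linarith), eq_comm, inv_mul_eq_iff_eq_mul₀ hnq.ne']
      linarith
    have hgreat : IsGreatest (slopeSet c J μ) (n : ℚ)⁻¹ := by
      refine ⟨Set.mem_insert_of_mem _ ⟨e₀, hmem₀, hslope₀⟩, fun s hs => ?_⟩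
      rcases Set.mem_insert_iff.mp hs with hz | ⟨e, he, rfl⟩
      · rw [hz]; exact (inv_pos.mpr hnq).le
      · have h1 : (alphaS c J μ : ℚ) < spt₁ μ e := by
          exact_mod_cast alphaS_lt_spt₁_of_mem_lowPts he
        have hh : ((alphaS c J μ + n * betaS c J μ : ℕ) : ℚ) ≤ ((spt₁ μ e + n * spt₂ μ e : ℕ) : ℚ) := by
          exact_mod_cast hhalf e he.1
        push_cast at hh
        unfold slopeOf
        rw [div_le_iff₀ (by linarith), le_inv_mul_iff₀ hnq]
        linarith
    exact (epsCu_isGreatest c J μ).unique hgreat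

end Basic

/-! ## Definition 10.8 -/

section VWP

variable [IsRegularLocalRing R]

/-- **Cutkosky 2009, Definition 10.8 — `(I; x, y, z)` is very well prepared** (tree form; see the
module docstring for the dictionary and the quantifier convention). With `c = (z, x, y) = (y, u₁, u₂)`,
`αs, βs, δs, γ⁻s` the scaled `α, β, γ, δ` and `epsCu / invEpsCu` Cutkosky's `ε`, `1/ε`; a reachable
system is `c' = (y + t, u₁, u₂ + φu₁)` ("a translation `y₁ = y − ηxⁿ`" ↔ `u₁^{n−1} ∣ φ`, "with
subsequent well preparation `z₁ = z − Ψ(x, y₁)`" ↔ `t ∈ (u₁, u₂)` and `c'` well prepared):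
"`(I; x, y, z)` will be said to be very well prepared if it is well prepared and one of the following
conditions holds. 1. `(γ − δ, δ) ≠ (α, β)` and if we make a translation `y₁ = y − ηx`, with subsequent
well preparation `z₁ = z − Ψ(x, y₁)`, then `α_{xy₁z₁}(I) = α`, `β_{xy₁z₁}(I) = β`, `γ_{xy₁z₁}(I) = γ`
and `δ_{xy₁z₁}(I) ≤ δ`. 2. `(γ − δ, δ) = (α, β)` and one of the following cases hold: a. `ε = 0`
b. `ε ≠ 0` and `1/ε` is not an integer c. `ε ≠ 0` and `n = 1/ε` is a (positive) integer and for any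
`η ∈ k`, if `y₁ = y − ηxⁿ` is a translation, with subsequent well preparation `z₁ = z − Ψ(x, y₁)`,
then `ε_{xy₁z₁}(I) = ε`. Further, if `(c, d)` is the lowest point on the line through `(α, β)` with
slope `−ε` in `|Δ(I; x, y, z)|` and `(c₁, d₁)` is the lowest point on this line in `|Δ(I; x, y₁, z₁)|`,
then `d₁ ≤ d`." The tree predicate quantifies over all `φ ∈ R` (resp. all `φ` with `u₁^{n−1} ∣ φ`)
and all `t ∈ (u₁, u₂)R`, hence implies the printed condition; the standing hypotheses of Def. 10.8
(`ν = r`, `τ = 1`, `dim Sing_r < 2`, good parameters) are carried by the theorems.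
[cite: Cutkosky2009, Def. 10.8, p. 30 l. 70 – p. 31 l. 14] -/
def VeryWellPrepared (c : Fin 3 → R) (J : Ideal R) (μ : ℕ) : Prop :=
  WellPrepared c J μ ∧
  ((¬ (deltaS c J μ = alphaS c J μ + gammaMinusS c J μ ∧ gammaMinusS c J μ = betaS c J μ) ∧
      ∀ (phi t : R), t ∈ Ideal.span ({c 1, c 2} : Set R) →
        WellPrepared (shiftZ (shiftU₂ c phi) t) J μ →
          alphaS (shiftZ (shiftU₂ c phi) t) J μ = alphaS c J μ ∧
          betaS (shiftZ (shiftU₂ c phi) t) J μ = betaS c J μ ∧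
          deltaS (shiftZ (shiftU₂ c phi) t) J μ = deltaS c J μ ∧
          gammaMinusS (shiftZ (shiftU₂ c phi) t) J μ ≤ gammaMinusS c J μ) ∨
    ((deltaS c J μ = alphaS c J μ + gammaMinusS c J μ ∧ gammaMinusS c J μ = betaS c J μ) ∧
      (epsCu c J μ = 0 ∨
        (epsCu c J μ ≠ 0 ∧ ∀ n : ℕ, invEpsCu c J μ ≠ ((n : ℚ) : WithTop ℚ)) ∨
        (∃ n : ℕ, 1 ≤ n ∧ invEpsCu c J μ = ((n : ℚ) : WithTop ℚ) ∧
          ∀ (phi t : R), c 1 ^ (n - 1) ∣ phi → t ∈ Ideal.span ({c 1, c 2} : Set R) →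
            WellPrepared (shiftZ (shiftU₂ c phi) t) J μ →
              epsCu (shiftZ (shiftU₂ c phi) t) J μ = epsCu c J μ ∧
              lowOrdS (shiftZ (shiftU₂ c phi) t) J μ 1 n (alphaS c J μ + n * betaS c J μ) ≤
                lowOrdS c J μ 1 n (alphaS c J μ + n * betaS c J μ)))))

variable {c : Fin 3 → R} {J : Ideal R} {μ : ℕ}

/-- A very well prepared system is well prepared. [cite: Cutkosky2009, Def. 10.8, p. 30 l. 72–73] -/
theorem VeryWellPrepared.wellPrepared (h : VeryWellPrepared c J μ) : WellPrepared c J μ := h.1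

/-- **Case 1 of Definition 10.8** as a constructor. [cite: Cutkosky2009, Def. 10.8 (1), p. 30 l. 74 – p. 31 l. 2] -/
theorem veryWellPrepared_of_case1 (hwp : WellPrepared c J μ)
    (hvw : ¬ (deltaS c J μ = alphaS c J μ + gammaMinusS c J μ ∧ gammaMinusS c J μ = betaS c J μ))
    (h : ∀ (phi t : R), t ∈ Ideal.span ({c 1, c 2} : Set R) →
      WellPrepared (shiftZ (shiftU₂ c phi) t) J μ →
        alphaS (shiftZ (shiftU₂ c phi) t) J μ = alphaS c J μ ∧
        betaS (shiftZ (shiftU₂ c phi) t) J μ = betaS c J μ ∧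
        deltaS (shiftZ (shiftU₂ c phi) t) J μ = deltaS c J μ ∧
        gammaMinusS (shiftZ (shiftU₂ c phi) t) J μ ≤ gammaMinusS c J μ) :
    VeryWellPrepared c J μ :=
  ⟨hwp, Or.inl ⟨hvw, h⟩⟩

/-- **Case 2a of Definition 10.8** (`w⁻ = v` and `ε = 0`). [cite: Cutkosky2009, Def. 10.8 (2)(a), p. 31 l. 3–4] -/
theorem veryWellPrepared_of_case2a (hwp : WellPrepared c J μ)
    (hvw : deltaS c J μ = alphaS c J μ + gammaMinusS c J μ ∧ gammaMinusS c J μ = betaS c J μ)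
    (hε : epsCu c J μ = 0) : VeryWellPrepared c J μ :=
  ⟨hwp, Or.inr ⟨hvw, Or.inl hε⟩⟩

/-- **Case 2b of Definition 10.8** (`w⁻ = v`, `ε ≠ 0`, `1/ε ∉ ℕ`). [cite: Cutkosky2009, Def. 10.8 (2)(b), p. 31 l. 5] -/
theorem veryWellPrepared_of_case2b (hwp : WellPrepared c J μ)
    (hvw : deltaS c J μ = alphaS c J μ + gammaMinusS c J μ ∧ gammaMinusS c J μ = betaS c J μ)
    (hε : epsCu c J μ ≠ 0) (hn : ∀ n : ℕ, invEpsCu c J μ ≠ ((n : ℚ) : WithTop ℚ)) :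
    VeryWellPrepared c J μ :=
  ⟨hwp, Or.inr ⟨hvw, Or.inr (Or.inl ⟨hε, hn⟩)⟩⟩

/-- **Case 2c of Definition 10.8** (`w⁻ = v`, `1/ε = n ∈ ℕ`, and the maximality along the line of slope
`−1/n`). [cite: Cutkosky2009, Def. 10.8 (2)(c), p. 31 l. 6–14] -/
theorem veryWellPrepared_of_case2c (hwp : WellPrepared c J μ)
    (hvw : deltaS c J μ = alphaS c J μ + gammaMinusS c J μ ∧ gammaMinusS c J μ = betaS c J μ)
    {n : ℕ} (hn : 1 ≤ n) (hinv : invEpsCu c J μ = ((n : ℚ) : WithTop ℚ))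
    (h : ∀ (phi t : R), c 1 ^ (n - 1) ∣ phi → t ∈ Ideal.span ({c 1, c 2} : Set R) →
      WellPrepared (shiftZ (shiftU₂ c phi) t) J μ →
        epsCu (shiftZ (shiftU₂ c phi) t) J μ = epsCu c J μ ∧
        lowOrdS (shiftZ (shiftU₂ c phi) t) J μ 1 n (alphaS c J μ + n * betaS c J μ) ≤
          lowOrdS c J μ 1 n (alphaS c J μ + n * betaS c J μ)) :
    VeryWellPrepared c J μ :=
  ⟨hwp, Or.inr ⟨hvw, Or.inr (Or.inr ⟨n, hn, hinv, h⟩)⟩⟩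

end VWP

/-! ## Towards Lemma 10.9: the rounds of the very well preparation procedure -/

section Rounds

variable [IsRegularLocalRing R] (c : Fin 3 → R)
  (hgen : Ideal.span {c 0, c 1, c 2} = maximalIdeal R) (hdim : ringKrullDim R = 3)
  {J : Ideal R} {μ : ℕ}

omit [IsRegularLocalRing R] in
/-- Cutkosky's `δ ≤ γ` (tree: `γ⁻s ≤ δs`; the point `(γ − δ, δ)` has non-negative abscissa).
[cite: Cutkosky2009, §10.1 p. 28 l. 31–35] -/
theorem gammaMinusS_le_deltaS (hne : (pts c J μ).Nonempty) : gammaMinusS c J μ ≤ deltaS c J μ :=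
  (gammaMinusS_le_gammaPlusS hne).trans (gammaPlusS_le_deltaS hne)

omit [IsRegularLocalRing R] in
/-- `1/ε` determines `ε`. [cite: Cutkosky2009, §10.1 p. 28 l. 38–53] -/
theorem epsCu_eq_of_invEpsCu_eq {R' : Type u} [CommRing R'] {c' : Fin 3 → R'} {J' : Ideal R'} {μ' : ℕ}
    (h : invEpsCu c' J' μ' = invEpsCu c J μ) : epsCu c' J' μ' = epsCu c J μ := by
  unfold invEpsCu at h
  split_ifs at h with h1 h2 h2
  · rw [h1, h2]
  · exact absurd h WithTop.top_ne_coe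
  · exact absurd h.symm WithTop.top_ne_coe
  · have := WithTop.coe_eq_coe.mp h
    exact inv_injective this

omit [IsRegularLocalRing R] in
/-- A natural value of `1/ε` is positive. [cite: Cutkosky2009, §10.1 p. 28 l. 38–53] -/
theorem one_le_of_invEpsCu_eq_natCast {n : ℕ} (h : invEpsCu c J μ = ((n : ℚ) : WithTop ℚ)) : 1 ≤ n := by
  rcases invEpsCu_top_or_pos (c := c) (J := J) (μ := μ) with htop | ⟨q, hq, hqe⟩
  · rw [htop] at h; exact absurd h WithTop.top_ne_coe
  · rw [hqe] at h
    have : q = n := WithTop.coe_eq_coe.mp h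
    rw [this] at hq
    exact_mod_cast hq

omit [IsRegularLocalRing R] in
/-- **No point below the line of slope `−1/n` through `v` forces `ε ≤ 1/n`** (all slopes down from `v`
are `≤ 1/n`). [cite: Cutkosky2009, §10.1 p. 28 l. 35–37] -/
theorem epsCu_le_inv_of_forall_slopeLine {n : ℕ} (hn : 1 ≤ n)
    (h : ∀ e ∈ pts c J μ, alphaS c J μ + n * betaS c J μ ≤ spt₁ μ e + n * spt₂ μ e) :
    epsCu c J μ ≤ (n : ℚ)⁻¹ := by
  have hnq : (0 : ℚ) < n := by exact_mod_cast hn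
  rcases epsCu_eq_zero_or_exists (c := c) (J := J) (μ := μ) with h0 | ⟨e, he, hslope⟩
  · rw [h0]; exact (inv_pos.mpr hnq).le
  · rw [← hslope]
    have h1 : (alphaS c J μ : ℚ) < spt₁ μ e := by exact_mod_cast alphaS_lt_spt₁_of_mem_lowPts he
    have hh : ((alphaS c J μ + n * betaS c J μ : ℕ) : ℚ) ≤ ((spt₁ μ e + n * spt₂ μ e : ℕ) : ℚ) := by
      exact_mod_cast h e he.1
    push_cast at hh
    unfold slopeOf
    rw [div_le_iff₀ (by linarith), le_inv_mul_iff₀ hnq]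
    linarith

omit [IsRegularLocalRing R] in
/-- If `w⁻ = v` (Cutkosky's `(γ − δ, δ) = (α, β)`) then `1/ε ≠ 1`, so a natural `1/ε` is `≥ 2`: a point
below the level `β` on the line of slope `−1` through `v` would be a lower point of the `δ`-line.
[cite: Cutkosky2009, Def. 10.8 (2), p. 31 l. 3–14] -/
theorem two_le_of_wMinus_eq_v (hne : (pts c J μ).Nonempty)
    (hvw : deltaS c J μ = alphaS c J μ + gammaMinusS c J μ ∧ gammaMinusS c J μ = betaS c J μ) {n : ℕ}
    (hn : 1 ≤ n) (hinv : invEpsCu c J μ = ((n : ℚ) : WithTop ℚ)) : 2 ≤ n := by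
  by_contra hlt
  have hn1 : n = 1 := by omega
  subst hn1
  obtain ⟨-, hlow⟩ := (invEpsCu_eq_natCast_iff c hne le_rfl).mp hinv
  obtain ⟨ev, hev, hev1, hev2⟩ := exists_pts_v hne
  obtain ⟨e₀, he₀, hl₀, hb₀⟩ := exists_pts_lowOrdS (c := c) (J := J) (μ := μ) (p₁ := 1) (p₂ := 1)
    (w₀ := alphaS c J μ + 1 * betaS c J μ) hev (by rw [hev1, hev2, one_mul])
  have hl₀' : spt₁ μ e₀ + spt₂ μ e₀ = deltaS c J μ := by
    rw [hvw.1, hvw.2]; simpa only [one_mul] using hl₀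
  have := gammaMinusS_le he₀ hl₀'
  omega

include hgen hdim in
/-- **The slope line transfers to every `n`-translation + well preparation**: if the polygon of the well
prepared `c` lies in the half-plane `x₁ + n x₂ ≥ αs + n βs` then so does the polygon of every well
prepared `(y + t, u₁, u₂ + φu₁)` with `u₁^{n−1} ∣ φ`, `t ∈ (u₁, u₂)` (Lemma 10.6 for the translation,
minimality for the preparation). [cite: Cutkosky2009, Lemma 10.6 p. 30 l. 59–63; Def. 10.8 (2)(c)] -/
theorem forall_pts_slopeLine_reach (hJμ : J ≤ maximalIdeal R ^ μ) (hmon : HasMonic c J μ)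
    (hne : (pts c J μ).Nonempty) {n : ℕ} (hn : 1 ≤ n)
    (h : ∀ e ∈ pts c J μ, alphaS c J μ + n * betaS c J μ ≤ spt₁ μ e + n * spt₂ μ e)
    {phi : R} (hphi : c 1 ^ (n - 1) ∣ phi) {t : R} (ht : t ∈ Ideal.span ({c 1, c 2} : Set R))
    (hwp' : WellPrepared (shiftZ (shiftU₂ c phi) t) J μ) :
    ∀ e ∈ pts (shiftZ (shiftU₂ c phi) t) J μ,
      alphaS c J μ + n * betaS c J μ ≤ spt₁ μ e + n * spt₂ μ e := by
  have hL := Nat.factorial_pos μ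
  obtain ⟨ev, hev, hev1, hev2⟩ := exists_pts_v hne
  have hw₀ : 0 < alphaS c J μ + n * betaS c J μ := by
    have := factorial_le_spt_add c hgen hdim hJμ hev
    rw [hev1, hev2] at this
    have : betaS c J μ ≤ n * betaS c J μ := Nat.le_mul_of_pos_left _ hn
    omega
  obtain ⟨k, hk⟩ : ∃ k, n = k + 1 := ⟨n - 1, by omega⟩
  have hphi' : c 1 ^ k ∣ phi := by rw [show k = n - 1 by omega]; exact hphi
  have h1 : ∀ e ∈ pts (shiftU₂ c phi) J μ,
      alphaS c J μ + n * betaS c J μ ≤ 1 * spt₁ μ e + (k + 1) * spt₂ μ e := by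
    refine forall_pts_shiftU₂_slopeLine_of_pow_dvd c hgen hdim hphi' hw₀ fun e he => ?_
    rw [one_mul, ← hk]; exact h e he
  intro e he
  have := forall_pts_reach_of_wellPrepared c hgen hdim hJμ hmon phi ht hwp' Nat.one_pos
    (by omega : 0 < k + 1) h1 e he
  rwa [one_mul, ← hk] at this

include hgen hdim in
/-- **One round of the very well preparation procedure** (proof of Lemma 10.9, p. 31 l. 21–28), for a
well prepared `c` with `(γ − δ, δ) = (α, β)` and `1/ε = n ∈ ℕ`: "We then choose `η ∈ k` such that
with the translation `y₁ = y − ηxⁿ`, and subsequent well preparation, we maximize `d` for points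
`(c, d)` of the line through `(α, β)` with slope `−ε` on the boundary of `|Δ(I; x, y₁, z₁)|`. By Lemma
10.7, `α, β` and `γ` are not changed. If we now have that `d ≠ β`, we are very well prepared."
Tree form: EITHER some `n`-translation + well preparation of `c` is very well prepared (case 2c with
the maximal `d < β`, or case 2a / 2b when the maximal `d` equals `β`), OR some `n`-translation + well
preparation of `c` is again well prepared with `w⁻ = v` and a LARGER natural `1/ε` (the edge of slope
`−1/n` has been removed). [cite: Cutkosky2009, proof of Lemma 10.9, p. 31 l. 15–33] -/
theorem round_step (hJμ : J ≤ maximalIdeal R ^ μ) (hmon : HasMonic c J μ)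
    (hne : (pts c J μ).Nonempty) (hwp : WellPrepared c J μ)
    (hvw : deltaS c J μ = alphaS c J μ + gammaMinusS c J μ ∧ gammaMinusS c J μ = betaS c J μ)
    {n : ℕ} (hn : 1 ≤ n) (hinv : invEpsCu c J μ = ((n : ℚ) : WithTop ℚ)) :
    (∃ psi s : R, c 1 ^ (n - 1) ∣ psi ∧ s ∈ Ideal.span ({c 1, c 2} : Set R) ∧
        VeryWellPrepared (shiftZ (shiftU₂ c psi) s) J μ) ∨
    (∃ (psi s : R) (n' : ℕ), c 1 ^ (n - 1) ∣ psi ∧ s ∈ Ideal.span ({c 1, c 2} : Set R) ∧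
        WellPrepared (shiftZ (shiftU₂ c psi) s) J μ ∧
        (deltaS (shiftZ (shiftU₂ c psi) s) J μ =
            alphaS (shiftZ (shiftU₂ c psi) s) J μ + gammaMinusS (shiftZ (shiftU₂ c psi) s) J μ ∧
          gammaMinusS (shiftZ (shiftU₂ c psi) s) J μ = betaS (shiftZ (shiftU₂ c psi) s) J μ) ∧
        n < n' ∧ invEpsCu (shiftZ (shiftU₂ c psi) s) J μ = ((n' : ℚ) : WithTop ℚ)) := by
  classical
  have h2n : 2 ≤ n := two_le_of_wMinus_eq_v c hne hvw hn hinv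
  obtain ⟨hhalf, -⟩ := (invEpsCu_eq_natCast_iff c hne hn).mp hinv
  -- the line of slope `−1/n` through `v`
  set w₀ := alphaS c J μ + n * betaS c J μ with hw₀def
  -- facts about every `n`-translation + well preparation `c'' = (y + s, u₁, u₂ + ψu₁)`
  have hreach : ∀ (psi s : R), c 1 ^ (n - 1) ∣ psi → s ∈ Ideal.span ({c 1, c 2} : Set R) →
      WellPrepared (shiftZ (shiftU₂ c psi) s) J μ →
      (pts (shiftZ (shiftU₂ c psi) s) J μ).Nonempty ∧
      alphaS (shiftZ (shiftU₂ c psi) s) J μ = alphaS c J μ ∧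
      betaS (shiftZ (shiftU₂ c psi) s) J μ = betaS c J μ ∧
      deltaS (shiftZ (shiftU₂ c psi) s) J μ = deltaS c J μ ∧
      gammaMinusS (shiftZ (shiftU₂ c psi) s) J μ = gammaMinusS c J μ ∧
      (∀ e ∈ pts (shiftZ (shiftU₂ c psi) s) J μ, w₀ ≤ spt₁ μ e + n * spt₂ μ e) := by
    intro psi s hpsi hs hwp'
    obtain ⟨e, he, -⟩ := exists_pts_reach_v c hgen hdim hJμ hmon hne hwp psi hs hwp'
    obtain ⟨hα, hβ, hδ, -⟩ := alphaS_betaS_deltaS_reach_eq c hgen hdim hJμ hmon hne hwp psi hs hwp'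
    have hγ := gammaMinusS_reach_eq_of_pow_dvd c hgen hdim hJμ hmon hne hwp (k := n - 1) (by omega)
      hpsi hs hwp'
    exact ⟨⟨e, he⟩, hα, hβ, hδ, hγ, forall_pts_slopeLine_reach c hgen hdim hJμ hmon hne hn hhalf hpsi hs hwp'⟩
  -- the set of attainable lowest ordinates `d` on the line, and its maximum `D ≤ βs`
  set S : Set ℕ := {d | ∃ psi s : R, c 1 ^ (n - 1) ∣ psi ∧ s ∈ Ideal.span ({c 1, c 2} : Set R) ∧
    WellPrepared (shiftZ (shiftU₂ c psi) s) J μ ∧ lowOrdS (shiftZ (shiftU₂ c psi) s) J μ 1 n w₀ = d}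
    with hSdef
  have hc0 : shiftZ (shiftU₂ c 0) 0 = c := by rw [shiftU₂_zero_eq, shiftZ_zero_eq]
  have hSne : S.Nonempty := ⟨_, 0, 0, dvd_zero _, Ideal.zero_mem _, by rw [hc0]; exact hwp, rfl⟩
  have hSbdd : BddAbove S := by
    refine ⟨betaS c J μ, ?_⟩
    rintro d ⟨psi, s, hpsi, hs, hwp', rfl⟩
    obtain ⟨hne', hα, hβ, -⟩ := hreach psi s hpsi hs hwp'
    have := lowOrdS_slopeLine_le_betaS (c := shiftZ (shiftU₂ c psi) s) (J := J) (μ := μ) hne' n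
    rw [hα, hβ] at this
    exact this
  obtain ⟨psi, s, hpsi, hs, hwp', hD⟩ := Nat.sSup_mem hSne hSbdd
  obtain ⟨hne', hα', hβ', hδ', hγ', hhalf'⟩ := hreach psi s hpsi hs hwp'
  have hvw' : deltaS (shiftZ (shiftU₂ c psi) s) J μ =
      alphaS (shiftZ (shiftU₂ c psi) s) J μ + gammaMinusS (shiftZ (shiftU₂ c psi) s) J μ ∧
      gammaMinusS (shiftZ (shiftU₂ c psi) s) J μ = betaS (shiftZ (shiftU₂ c psi) s) J μ := by
    rw [hα', hβ', hδ', hγ']; exact hvw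
  have hDle : lowOrdS (shiftZ (shiftU₂ c psi) s) J μ 1 n w₀ ≤ betaS c J μ := by
    have := lowOrdS_slopeLine_le_betaS (c := shiftZ (shiftU₂ c psi) s) (J := J) (μ := μ) hne' n
    rw [hα', hβ'] at this; exact this
  -- maximality of `D`, for every further `n`-translation + well preparation (composed form)
  have hmax : ∀ (phi t : R), c 1 ^ (n - 1) ∣ phi → t ∈ Ideal.span ({c 1, c 2} : Set R) →
      WellPrepared (shiftZ (shiftU₂ c (psi + phi)) (s + t)) J μ →
      lowOrdS (shiftZ (shiftU₂ c (psi + phi)) (s + t)) J μ 1 n w₀ ≤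
        lowOrdS (shiftZ (shiftU₂ c psi) s) J μ 1 n w₀ := by
    intro phi t hphi ht hwp''
    rw [hD]
    exact le_csSup hSbdd ⟨psi + phi, s + t, dvd_add hpsi hphi, Ideal.add_mem _ hs ht, hwp'', rfl⟩
  by_cases hlt : lowOrdS (shiftZ (shiftU₂ c psi) s) J μ 1 n w₀ < betaS c J μ
  · -- `d < β`: the maximiser is very well prepared (case 2c)
    refine Or.inl ⟨psi, s, hpsi, hs, ?_⟩
    have hinv' : invEpsCu (shiftZ (shiftU₂ c psi) s) J μ = ((n : ℚ) : WithTop ℚ) := by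
      refine (invEpsCu_eq_natCast_iff _ hne' hn).mpr ⟨?_, ?_⟩
      · rw [hα', hβ']; exact hhalf'
      · rw [hα', hβ']; exact hlt
    refine veryWellPrepared_of_case2c hwp' hvw' hn hinv' fun phi t hphi ht hwp'' => ?_
    rw [shiftZ_one, shiftU₂_one] at hphi
    rw [span_pair_shiftZ, span_pair_shiftU₂] at ht
    rw [reach_reach] at hwp'' ⊢
    rw [hα', hβ']
    refine ⟨?_, hmax phi t hphi ht hwp''⟩
    -- `ε` of the new system is again `1/n`
    obtain ⟨hne'', hα'', hβ'', -, -, hhalf''⟩ :=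
      hreach (psi + phi) (s + t) (dvd_add hpsi hphi) (Ideal.add_mem _ hs ht) hwp''
    have hinv'' : invEpsCu (shiftZ (shiftU₂ c (psi + phi)) (s + t)) J μ = ((n : ℚ) : WithTop ℚ) := by
      refine (invEpsCu_eq_natCast_iff _ hne'' hn).mpr ⟨?_, ?_⟩
      · rw [hα'', hβ'']; exact hhalf''
      · rw [hα'', hβ'']; exact lt_of_le_of_lt (hmax phi t hphi ht hwp'') hlt
    exact epsCu_eq_of_invEpsCu_eq _ (hinv''.trans hinv'.symm)
  · -- `d = β`: the edge is gone; `1/ε` now exceeds `n`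
    have hDeq : lowOrdS (shiftZ (shiftU₂ c psi) s) J μ 1 n w₀ = betaS c J μ :=
      le_antisymm hDle (not_lt.mp hlt)
    have hnq : (0 : ℚ) < n := by exact_mod_cast hn
    have hεle : epsCu (shiftZ (shiftU₂ c psi) s) J μ ≤ (n : ℚ)⁻¹ :=
      epsCu_le_inv_of_forall_slopeLine _ hn (by rw [hα', hβ']; exact hhalf')
    have hεne : epsCu (shiftZ (shiftU₂ c psi) s) J μ ≠ (n : ℚ)⁻¹ := by
      intro heq
      have hinv' : invEpsCu (shiftZ (shiftU₂ c psi) s) J μ = ((n : ℚ) : WithTop ℚ) := by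
        unfold invEpsCu
        rw [if_neg (by rw [heq]; exact inv_ne_zero hnq.ne'), heq, inv_inv]
      obtain ⟨-, hlow⟩ := (invEpsCu_eq_natCast_iff _ hne' hn).mp hinv'
      rw [hα', hβ', hDeq] at hlow
      exact lt_irrefl _ hlow
    by_cases hε0 : epsCu (shiftZ (shiftU₂ c psi) s) J μ = 0
    · exact Or.inl ⟨psi, s, hpsi, hs, veryWellPrepared_of_case2a hwp' hvw' hε0⟩
    · by_cases hnat : ∃ n' : ℕ, invEpsCu (shiftZ (shiftU₂ c psi) s) J μ = ((n' : ℚ) : WithTop ℚ)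
      · obtain ⟨n', hn'⟩ := hnat
        refine Or.inr ⟨psi, s, n', hpsi, hs, hwp', hvw', ?_, hn'⟩
        -- `n < n'`: `ε' < 1/n`
        have hεlt : epsCu (shiftZ (shiftU₂ c psi) s) J μ < (n : ℚ)⁻¹ := lt_of_le_of_ne hεle hεne
        have hεpos : 0 < epsCu (shiftZ (shiftU₂ c psi) s) J μ :=
          lt_of_le_of_ne (epsCu_nonneg _ J μ) (Ne.symm hε0)
        have hq : invEpsCu (shiftZ (shiftU₂ c psi) s) J μ =
            (((epsCu (shiftZ (shiftU₂ c psi) s) J μ)⁻¹ : ℚ) : WithTop ℚ) := by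
          unfold invEpsCu; rw [if_neg hε0]
        rw [hq] at hn'
        have hn'q : (epsCu (shiftZ (shiftU₂ c psi) s) J μ)⁻¹ = (n' : ℚ) := WithTop.coe_eq_coe.mp hn'
        have : (n : ℚ) < n' := by
          rw [← hn'q, ← inv_inv (n : ℚ)]
          exact (inv_lt_inv₀ (inv_pos.mpr hnq) hεpos).mpr hεlt
        exact_mod_cast this
      · push Not at hnat
        exact Or.inl ⟨psi, s, hpsi, hs, veryWellPrepared_of_case2b hwp' hvw' hε0 hnat⟩

include hgen hdim in
/-- **The first step of Lemma 10.9's proof**: "By Lemmas 10.4 and 10.7, we can find good parameters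
`x, y, z` for `I` such that `(I; x, y, z)` is well prepared, `α, β, γ` do not change under translation
`y₁ = y − ηx` followed by subsequent well preparation, and `δ` is maximal." Tree form: among the well
prepared systems `(y + t, u₁, u₂ + φu₁)` reachable from a well prepared `c`, Cutkosky's `δ` (tree
`γ⁻s`, bounded by `δs`) attains its maximum at some `c'`, and every well prepared system reachable from
`c'` is reachable from `c`. [cite: Cutkosky2009, proof of Lemma 10.9, p. 31 l. 15–18] -/
theorem exists_reach_isMax_gammaMinusS (hJμ : J ≤ maximalIdeal R ^ μ) (hmon : HasMonic c J μ)
    (hne : (pts c J μ).Nonempty) (hwp : WellPrepared c J μ) :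
    ∃ phi t : R, t ∈ Ideal.span ({c 1, c 2} : Set R) ∧ WellPrepared (shiftZ (shiftU₂ c phi) t) J μ ∧
      ∀ (phi' t' : R), t' ∈ Ideal.span ({(shiftZ (shiftU₂ c phi) t) 1, (shiftZ (shiftU₂ c phi) t) 2} : Set R) →
        WellPrepared (shiftZ (shiftU₂ (shiftZ (shiftU₂ c phi) t) phi') t') J μ →
        gammaMinusS (shiftZ (shiftU₂ (shiftZ (shiftU₂ c phi) t) phi') t') J μ ≤
          gammaMinusS (shiftZ (shiftU₂ c phi) t) J μ := by
  classical
  set S : Set ℕ := {g | ∃ phi t : R, t ∈ Ideal.span ({c 1, c 2} : Set R) ∧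
    WellPrepared (shiftZ (shiftU₂ c phi) t) J μ ∧ gammaMinusS (shiftZ (shiftU₂ c phi) t) J μ = g}
    with hSdef
  have hc0 : shiftZ (shiftU₂ c 0) 0 = c := by rw [shiftU₂_zero_eq, shiftZ_zero_eq]
  have hSne : S.Nonempty := ⟨_, 0, 0, Ideal.zero_mem _, by rw [hc0]; exact hwp, rfl⟩
  have hSbdd : BddAbove S := by
    refine ⟨deltaS c J μ, ?_⟩
    rintro g ⟨phi, t, ht, hwp', rfl⟩
    obtain ⟨e, he, -⟩ := exists_pts_reach_v c hgen hdim hJμ hmon hne hwp phi ht hwp'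
    obtain ⟨-, -, hδ, -⟩ := alphaS_betaS_deltaS_reach_eq c hgen hdim hJμ hmon hne hwp phi ht hwp'
    rw [← hδ]
    exact gammaMinusS_le_deltaS _ ⟨e, he⟩
  obtain ⟨phi, t, ht, hwp', hM⟩ := Nat.sSup_mem hSne hSbdd
  refine ⟨phi, t, ht, hwp', fun phi' t' ht' hwp'' => ?_⟩
  rw [span_pair_shiftZ, span_pair_shiftU₂] at ht'
  rw [reach_reach] at hwp'' ⊢
  rw [hM]
  exact le_csSup hSbdd ⟨phi + phi', t + t', Ideal.add_mem _ ht ht', hwp'', rfl⟩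

end Rounds

/-! ## Lemma 10.9: very well prepared parameters exist (complete `R`) -/

section Existence

variable [IsRegularLocalRing R] (c : Fin 3 → R)
  (hgen : Ideal.span {c 0, c 1, c 2} = maximalIdeal R) (hdim : ringKrullDim R = 3)
  {J : Ideal R} {μ : ℕ}

omit [IsRegularLocalRing R] in
/-- **Deep perturbations of the parameters do not change low levels of the weighted filtration**: if
`c′ᵢ − cᵢ ∈ 𝔪^N` with `N ≥ wᵢ` for all `i` (positive weights, `c` generating `𝔪`), then
`F^{w}_ρ(c′) ⊆ F^{w}_ρ(c)` for every `ρ` (each `c′ᵢ` has `c`-weighted order `≥ wᵢ`). Used for the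
limit translation `y' = y − φ(x)` of Lemma 10.9. [cite: Cutkosky2009, proof of Lemma 10.9, p. 31 l. 29–33] -/
theorem weightedIdealW_le_of_forall_sub_mem_pow [IsLocalRing R] (c c' : Fin 3 → R)
    (hgenr : Ideal.span (Set.range c) = maximalIdeal R) {w : Fin 3 → ℕ} (hw : ∀ i, 0 < w i)
    {N : ℕ} (hN : ∀ i, w i ≤ N) (h : ∀ i, c' i - c i ∈ maximalIdeal R ^ N) (ρ : ℕ) :
    weightedIdealW c' w ρ ≤ weightedIdealW c w ρ := by
  refine weightedIdealW_le_of_forall_apply_mem c c' w (fun i => ?_) ρ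
  have : c' i = c i + (c' i - c i) := by ring
  rw [this]
  exact Ideal.add_mem _ (apply_mem_weightedIdealW c w i)
    (weightedIdealW_antitone c w (hN i) (pow_maximalIdeal_le_weightedIdealW c hgenr hw N (h i)))

include hgen hdim in
/-- The standing facts about a well prepared system `(y + t, u₁, u₂ + φu₁)` reached from a well prepared
`c` (bookkeeping for Lemma 10.9): it generates `𝔪`, keeps the `Y^μ`-corner, has a non-empty polygon
and the same `αs, βs, δs` (Lemma 10.7). [cite: Cutkosky2009, Lemma 10.7 p. 30 l. 67–69] -/
theorem reach_facts (hJμ : J ≤ maximalIdeal R ^ μ) (hmon : HasMonic c J μ)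
    (hne : (pts c J μ).Nonempty) (hwp : WellPrepared c J μ) (phi : R) {t : R}
    (ht : t ∈ Ideal.span ({c 1, c 2} : Set R)) (hwp' : WellPrepared (shiftZ (shiftU₂ c phi) t) J μ) :
    Ideal.span {shiftZ (shiftU₂ c phi) t 0, shiftZ (shiftU₂ c phi) t 1, shiftZ (shiftU₂ c phi) t 2} =
        maximalIdeal R ∧
      HasMonic (shiftZ (shiftU₂ c phi) t) J μ ∧ (pts (shiftZ (shiftU₂ c phi) t) J μ).Nonempty ∧
      alphaS (shiftZ (shiftU₂ c phi) t) J μ = alphaS c J μ ∧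
      betaS (shiftZ (shiftU₂ c phi) t) J μ = betaS c J μ ∧
      deltaS (shiftZ (shiftU₂ c phi) t) J μ = deltaS c J μ := by
  obtain ⟨e, he, -⟩ := exists_pts_reach_v c hgen hdim hJμ hmon hne hwp phi ht hwp'
  obtain ⟨hα, hβ, hδ, -⟩ := alphaS_betaS_deltaS_reach_eq c hgen hdim hJμ hmon hne hwp phi ht hwp'
  exact ⟨span_triple_reach c hgen phi ht, hasMonic_reach c hgen hdim hJμ hmon phi ht, ⟨e, he⟩, hα, hβ, hδ⟩

include hgen hdim in
/-- **Cutkosky 2009, Lemma 10.9 (existence of very well prepared parameters), tree form, from a well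
prepared start.** "Suppose that `I ⊂ T` is an ideal such that `ν_T(I) = r`, `τ(I) = 1`, `Sing_r(I)` has
dimension `< 2` and `(x, y, z)` are good parameters for `I`. Then there are formal substitutions
`z₁ = z − Ψ(x, y)`, `y₁ = y − φ(x)` where `Ψ(x, y)`, `φ(x)` are series such that `(I; x, y₁, z₁)` is very
well prepared." Tree hypotheses: `R` regular local of dimension `3`, complete; `c = (y, u₁, u₂)` a
regular system of parameters, well prepared, with `J ⊆ 𝔪^μ`, a `Y^μ`-corner (good parameters),
non-empty polygon and `δs > L` (i.e. `z = 0` is an approximate manifold, which under `τ = 1` is Lemma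
10.1 for a well prepared system), and «`J ⊄ ((y + t)^μ)` for every `t ∈ (u₁, u₂)`» (the tree's algebraic
reading of "`Sing_r(I)` has dimension `< 2`", `TotalPreparation`). Conclusion: some reachable system
`(y + t, u₁, u₂ + φu₁)`, `φ ∈ R`, `t ∈ (u₁, u₂)R`, is very well prepared (TODO(printed form): `φ` a series
in `x` alone and `Ψ` one in `x, y` — not needed downstream). PROOF = the printed one: maximise `δ`
(`exists_reach_isMax_gammaMinusS`); if `(γ − δ, δ) ≠ (α, β)` this is case 1; otherwise run the rounds
(`round_step`), each either ending very well prepared or producing a larger natural `1/ε` with a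
translation `y ↦ y − ηxⁿ`; "If the process does not end after a finite number of iterations, then we
construct formal series `y' = y − φ(x)` and `z' = z − ψ(x, y)` such that `|Δ(I; x, y', z')|` has the
single vertex `(α, β)`": the translations converge `𝔪`-adically, ONE total preparation of the limit
translation (`TotalPreparation`) is well prepared, lies (by minimality, Lemma 10.6 and
`weightedIdealW_le_of_forall_sub_mem_pow`) in every half-plane `x₁ + n_k x₂ ≥ αs + n_k βs` with
`n_k → ∞`, hence has no Newton point below `β`: `ε = 0`, case 2a.
[cite: Cutkosky2009, Lemma 10.9 and its proof, p. 31 l. 15–33] -/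
theorem exists_veryWellPrepared_of_wellPrepared [IsAdicComplete (maximalIdeal R) R]
    (hJμ : J ≤ maximalIdeal R ^ μ) (hmon : HasMonic c J μ) (hne : (pts c J μ).Nonempty)
    (hwp : WellPrepared c J μ) (hδ : μ.factorial < deltaS c J μ)
    (hJ : ∀ t ∈ Ideal.span ({c 1, c 2} : Set R), ¬ J ≤ Ideal.span {(c 0 + t) ^ μ}) :
    ∃ phi t : R, t ∈ Ideal.span ({c 1, c 2} : Set R) ∧
      VeryWellPrepared (shiftZ (shiftU₂ c phi) t) J μ := by
  classical
  by_contra H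
  push Not at H
  have hL := Nat.factorial_pos μ
  have hgenr := span_range_eq_of_span_triple c hgen
  have hc1 : c 1 ∈ maximalIdeal R := by rw [← hgen]; exact Ideal.subset_span (by simp)
  -- Step 1: maximise Cutkosky's `δ`
  obtain ⟨φ₁, t₁, ht₁, hwp₁, hmax₁⟩ := exists_reach_isMax_gammaMinusS c hgen hdim hJμ hmon hne hwp
  obtain ⟨-, -, hne₁, hα₁, hβ₁, hδ₁⟩ := reach_facts c hgen hdim hJμ hmon hne hwp φ₁ ht₁ hwp₁
  -- `w⁻ = v` at the maximiser (else case 1 is very well prepared)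
  have hvw₁ : deltaS (shiftZ (shiftU₂ c φ₁) t₁) J μ =
      alphaS (shiftZ (shiftU₂ c φ₁) t₁) J μ + gammaMinusS (shiftZ (shiftU₂ c φ₁) t₁) J μ ∧
      gammaMinusS (shiftZ (shiftU₂ c φ₁) t₁) J μ = betaS (shiftZ (shiftU₂ c φ₁) t₁) J μ := by
    by_contra hvw
    refine H φ₁ t₁ ht₁ (veryWellPrepared_of_case1 hwp₁ hvw fun phi t ht hwp' => ?_)
    rw [span_pair_shiftZ, span_pair_shiftU₂] at ht
    have hmax := hmax₁ phi t (by rw [span_pair_shiftZ, span_pair_shiftU₂]; exact ht) hwp'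
    rw [reach_reach] at hwp' hmax ⊢
    obtain ⟨-, -, -, hα', hβ', hδ'⟩ :=
      reach_facts c hgen hdim hJμ hmon hne hwp (φ₁ + phi) (Ideal.add_mem _ ht₁ ht) hwp'
    exact ⟨hα'.trans hα₁.symm, hβ'.trans hβ₁.symm, hδ'.trans hδ₁.symm, hmax⟩
  have hε₁ : epsCu (shiftZ (shiftU₂ c φ₁) t₁) J μ ≠ 0 := fun h0 =>
    H φ₁ t₁ ht₁ (veryWellPrepared_of_case2a hwp₁ hvw₁ h0)
  obtain ⟨n₁, hn₁inv⟩ : ∃ n : ℕ, invEpsCu (shiftZ (shiftU₂ c φ₁) t₁) J μ = ((n : ℚ) : WithTop ℚ) := by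
    by_contra hno
    push Not at hno
    exact H φ₁ t₁ ht₁ (veryWellPrepared_of_case2b hwp₁ hvw₁ hε₁ hno)
  have hn₁ : 1 ≤ n₁ := one_le_of_invEpsCu_eq_natCast _ hn₁inv
  -- the rounds never stop: from every state a next state with larger `1/ε`
  have hstep : ∀ (φ t : R) (n : ℕ), t ∈ Ideal.span ({c 1, c 2} : Set R) →
      WellPrepared (shiftZ (shiftU₂ c φ) t) J μ →
      (deltaS (shiftZ (shiftU₂ c φ) t) J μ =
          alphaS (shiftZ (shiftU₂ c φ) t) J μ + gammaMinusS (shiftZ (shiftU₂ c φ) t) J μ ∧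
        gammaMinusS (shiftZ (shiftU₂ c φ) t) J μ = betaS (shiftZ (shiftU₂ c φ) t) J μ) →
      1 ≤ n → invEpsCu (shiftZ (shiftU₂ c φ) t) J μ = ((n : ℚ) : WithTop ℚ) →
      ∃ (φ' t' : R) (n' : ℕ), c 1 ^ (n - 1) ∣ φ' - φ ∧ t' ∈ Ideal.span ({c 1, c 2} : Set R) ∧
        WellPrepared (shiftZ (shiftU₂ c φ') t') J μ ∧
        (deltaS (shiftZ (shiftU₂ c φ') t') J μ =
            alphaS (shiftZ (shiftU₂ c φ') t') J μ + gammaMinusS (shiftZ (shiftU₂ c φ') t') J μ ∧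
          gammaMinusS (shiftZ (shiftU₂ c φ') t') J μ = betaS (shiftZ (shiftU₂ c φ') t') J μ) ∧
        n < n' ∧ invEpsCu (shiftZ (shiftU₂ c φ') t') J μ = ((n' : ℚ) : WithTop ℚ) := by
    intro φ t n ht hwpt hvwt hn hinv
    obtain ⟨hgen', hmon', hne', -⟩ := reach_facts c hgen hdim hJμ hmon hne hwp φ ht hwpt
    rcases round_step (shiftZ (shiftU₂ c φ) t) hgen' hdim hJμ hmon' hne' hwpt hvwt hn hinv with
      ⟨ψ, s, hψ, hs, hV⟩ | ⟨ψ, s, n', hψ, hs, hwp', hvw', hlt, hinv'⟩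
    · rw [span_pair_shiftZ, span_pair_shiftU₂] at hs
      rw [reach_reach] at hV
      exact absurd hV (H _ _ (Ideal.add_mem _ ht hs))
    · rw [shiftZ_one, shiftU₂_one] at hψ
      rw [span_pair_shiftZ, span_pair_shiftU₂] at hs
      rw [reach_reach] at hwp' hvw' hinv'
      exact ⟨φ + ψ, t + s, n', by rw [add_sub_cancel_left]; exact hψ, Ideal.add_mem _ ht hs, hwp',
        hvw', hlt, hinv'⟩
  choose! Fφ Ft Fn hF using hstep
  -- the sequence of states `(φ_k, t_k, n_k)`
  let st : ℕ → R × R × ℕ := fun k =>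
    Nat.rec (motive := fun _ => R × R × ℕ) (φ₁, t₁, n₁)
      (fun _ x => (Fφ x.1 x.2.1 x.2.2, Ft x.1 x.2.1 x.2.2, Fn x.1 x.2.1 x.2.2)) k
  obtain ⟨φs, hφs⟩ : ∃ f : ℕ → R, ∀ k, f k = (st k).1 := ⟨_, fun _ => rfl⟩
  obtain ⟨ts, hts⟩ : ∃ f : ℕ → R, ∀ k, f k = (st k).2.1 := ⟨_, fun _ => rfl⟩
  obtain ⟨ns, hns⟩ : ∃ f : ℕ → ℕ, ∀ k, f k = (st k).2.2 := ⟨_, fun _ => rfl⟩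
  have h0 : φs 0 = φ₁ ∧ ts 0 = t₁ ∧ ns 0 = n₁ := ⟨hφs 0, hts 0, hns 0⟩
  have hS : ∀ k, φs (k + 1) = Fφ (φs k) (ts k) (ns k) ∧ ts (k + 1) = Ft (φs k) (ts k) (ns k) ∧
      ns (k + 1) = Fn (φs k) (ts k) (ns k) := by
    intro k
    refine ⟨?_, ?_, ?_⟩
    · rw [hφs, hφs, hts, hns]
    · rw [hts, hφs, hts, hns]
    · rw [hns, hφs, hts, hns]
  -- invariant of the states
  have hInv : ∀ k, ts k ∈ Ideal.span ({c 1, c 2} : Set R) ∧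
      WellPrepared (shiftZ (shiftU₂ c (φs k)) (ts k)) J μ ∧
      (deltaS (shiftZ (shiftU₂ c (φs k)) (ts k)) J μ =
          alphaS (shiftZ (shiftU₂ c (φs k)) (ts k)) J μ +
            gammaMinusS (shiftZ (shiftU₂ c (φs k)) (ts k)) J μ ∧
        gammaMinusS (shiftZ (shiftU₂ c (φs k)) (ts k)) J μ =
          betaS (shiftZ (shiftU₂ c (φs k)) (ts k)) J μ) ∧
      1 ≤ ns k ∧ invEpsCu (shiftZ (shiftU₂ c (φs k)) (ts k)) J μ = ((ns k : ℚ) : WithTop ℚ) := by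
    intro k
    induction k with
    | zero => rw [h0.1, h0.2.1, h0.2.2]; exact ⟨ht₁, hwp₁, hvw₁, hn₁, hn₁inv⟩
    | succ k ih =>
      obtain ⟨h1, h2, h3, h4, h5⟩ := ih
      obtain ⟨-, h2', h3', h4', hlt, h5'⟩ := hF _ _ _ h1 h2 h3 h4 h5
      rw [(hS k).1, (hS k).2.1, (hS k).2.2]
      exact ⟨h2', h3', h4', by omega, h5'⟩
  have hrel : ∀ k, c 1 ^ (ns k - 1) ∣ φs (k + 1) - φs k ∧ ns k < ns (k + 1) := by
    intro k
    obtain ⟨h1, h2, h3, h4, h5⟩ := hInv k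
    obtain ⟨hdvd, -, -, -, hlt, -⟩ := hF _ _ _ h1 h2 h3 h4 h5
    rw [(hS k).1, (hS k).2.2]
    exact ⟨hdvd, hlt⟩
  have hmono : ∀ k m, k ≤ m → ns k ≤ ns m := by
    intro k m hkm
    induction m, hkm using Nat.le_induction with
    | base => exact le_rfl
    | succ m _ ih => exact ih.trans (hrel m).2.le
  have hnk : ∀ k, k + 1 ≤ ns k := by
    intro k
    induction k with
    | zero => rw [h0.2.2]; exact hn₁
    | succ k ih => have := (hrel k).2; omega
  -- the partial sums stay divisible, hence Cauchy
  have hdiv : ∀ k m, k ≤ m → c 1 ^ (ns k - 1) ∣ φs m - φs k := by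
    intro k m hkm
    induction m, hkm using Nat.le_induction with
    | base => simp
    | succ m hkm ih =>
      have hrw : φs (m + 1) - φs k = (φs (m + 1) - φs m) + (φs m - φs k) := by ring
      rw [hrw]
      refine dvd_add ?_ ih
      exact (pow_dvd_pow _ (by have := hmono k m hkm; omega)).trans (hrel m).1
  have hmem : ∀ k m, k ≤ m → φs m - φs k ∈ maximalIdeal R ^ k := by
    intro k m hkm
    obtain ⟨q, hq⟩ := hdiv k m hkm
    rw [hq]
    exact Ideal.mul_mem_right _ _ (Ideal.pow_le_pow_right (I := maximalIdeal R)
      (show k ≤ ns k - 1 by have := hnk k; omega) (Ideal.pow_mem_pow hc1 _))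
  have hcauchy : ∀ {k m : ℕ}, k ≤ m →
      φs k ≡ φs m [SMOD (maximalIdeal R ^ k • ⊤ : Submodule R R)] := by
    intro k m hkm
    rw [SModEq.sub_mem, Ideal.smul_eq_mul, Ideal.mul_top, ← neg_sub]
    exact Submodule.neg_mem _ (hmem k m hkm)
  obtain ⟨φl, hφl⟩ := IsPrecomplete.prec (inferInstance : IsPrecomplete (maximalIdeal R) R) hcauchy
  have hlim : ∀ k, φl - φs k ∈ maximalIdeal R ^ k := by
    intro k
    have := hφl k
    rw [SModEq.sub_mem, Ideal.smul_eq_mul, Ideal.mul_top] at this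
    rw [← neg_sub]; exact Submodule.neg_mem _ this
  -- one total preparation of the limit translation
  have hgenl : Ideal.span {shiftU₂ c φl 0, shiftU₂ c φl 1, shiftU₂ c φl 2} = maximalIdeal R := by
    rw [span_triple_shiftU₂]; exact hgen
  have hδl : μ.factorial < deltaS (shiftU₂ c φl) J μ := by
    rw [deltaS_shiftU₂ c hgen hdim φl hJμ hne]; exact hδ
  have hJl : ∀ t ∈ Ideal.span ({shiftU₂ c φl 1, shiftU₂ c φl 2} : Set R),
      ¬ J ≤ Ideal.span {(shiftU₂ c φl 0 + t) ^ μ} := by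
    rw [span_pair_shiftU₂, shiftU₂_zero]; exact hJ
  obtain ⟨cs, hcs1, hcs2, -, hθspan, -, -, -, -, hwpcs⟩ :=
    exists_preparedUpTo_forall_of_forall_not_le hdim (shiftU₂ c φl) hgenl hJl hδl
  rw [shiftU₂_zero, shiftU₂_one, shiftU₂_two] at hθspan
  obtain ⟨θ, hθdef⟩ : ∃ θ, cs 0 - c 0 = θ := ⟨_, rfl⟩
  rw [hθdef] at hθspan
  have hθ : θ ∈ Ideal.span ({c 1, c 2} : Set R) := by
    have h := span_pair_shiftU₂ c φl
    rw [shiftU₂_one, shiftU₂_two] at h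
    rw [h] at hθspan; exact hθspan
  have hcs_eq : cs = shiftZ (shiftU₂ c φl) θ := by
    funext i
    fin_cases i
    · show cs 0 = c 0 + θ
      rw [← hθdef]; ring
    · exact hcs1
    · exact hcs2
  have hwpl : WellPrepared (shiftZ (shiftU₂ c φl) θ) J μ := by
    intro B; rw [← hcs_eq]; exact hwpcs B
  obtain ⟨hgen_l, hmon_l, hne_l, hα_l, hβ_l, hδ_l⟩ := reach_facts c hgen hdim hJμ hmon hne hwp φl hθ hwpl
  -- every slope line `x₁ + n_k x₂ ≥ αs + n_k βs` is valid on the final polygon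
  have hH : ∀ k, ∀ e ∈ pts (shiftZ (shiftU₂ c φl) θ) J μ,
      alphaS c J μ + ns k * betaS c J μ ≤ spt₁ μ e + ns k * spt₂ μ e := by
    intro k
    obtain ⟨htk, hwpk, -, hnk1, hinvk⟩ := hInv k
    obtain ⟨hgenk, hmonk, hnek, hαk, hβk, -⟩ := reach_facts c hgen hdim hJμ hmon hne hwp (φs k) htk hwpk
    set w₀ := alphaS c J μ + ns k * betaS c J μ with hw₀
    have hw₀pos : 0 < w₀ := by
      obtain ⟨ev, hev, hev1, hev2⟩ := exists_pts_v hne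
      have := factorial_le_spt_add c hgen hdim hJμ hev
      rw [hev1, hev2] at this
      have : betaS c J μ ≤ ns k * betaS c J μ := Nat.le_mul_of_pos_left _ hnk1
      omega
    -- (a) on the state system
    have ha : ∀ e ∈ pts (shiftZ (shiftU₂ c (φs k)) (ts k)) J μ,
        w₀ ≤ 1 * spt₁ μ e + (ns k - 1 + 1) * spt₂ μ e := by
      have := ((invEpsCu_eq_natCast_iff _ hnek hnk1).mp hinvk).1
      rw [hαk, hβk] at this
      intro e he; rw [one_mul, Nat.sub_add_cancel hnk1]; exact this e he
    -- (b) transfer to a far enough partial translation `φ_N`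
    set N := w₀ + μ.factorial * ns k + k with hN
    have hkN : k ≤ N := by omega
    have hb := forall_pts_shiftU₂_slopeLine_of_pow_dvd (shiftZ (shiftU₂ c (φs k)) (ts k)) hgenk hdim
      (phi := φs N - φs k) (k := ns k - 1) (by rw [shiftZ_one, shiftU₂_one]; exact hdiv k N hkN)
      hw₀pos ha
    have heqN : shiftU₂ (shiftZ (shiftU₂ c (φs k)) (ts k)) (φs N - φs k) =
        shiftZ (shiftU₂ c (φs N)) (ts k) := by
      rw [shiftU₂_shiftZ, shiftU₂_shiftU₂, add_sub_cancel]
    rw [heqN] at hb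
    -- (c) perturb `φ_N` to the limit `φl`
    have hgenN : Ideal.span {shiftZ (shiftU₂ c (φs N)) (ts k) 0, shiftZ (shiftU₂ c (φs N)) (ts k) 1,
        shiftZ (shiftU₂ c (φs N)) (ts k) 2} = maximalIdeal R := span_triple_reach c hgen (φs N) htk
    have hgenlk : Ideal.span {shiftZ (shiftU₂ c φl) (ts k) 0, shiftZ (shiftU₂ c φl) (ts k) 1,
        shiftZ (shiftU₂ c φl) (ts k) 2} = maximalIdeal R := span_triple_reach c hgen φl htk
    have hnspos : 0 < ns k - 1 + 1 := Nat.succ_pos _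
    have hJW := (le_weightedIdealW_levelWeight_iff _ hgenN hdim J hw₀pos Nat.one_pos hnspos).mpr hb
    have hWpos : ∀ i, 0 < levelWeight μ w₀ 1 (ns k - 1 + 1) i := levelWeight_pos hw₀pos Nat.one_pos hnspos
    have hWN : ∀ i, levelWeight μ w₀ 1 (ns k - 1 + 1) i ≤ N := by
      intro i
      fin_cases i
      · show levelWeight μ w₀ 1 (ns k - 1 + 1) 0 ≤ N
        rw [levelWeight_zero]; omega
      · show levelWeight μ w₀ 1 (ns k - 1 + 1) 1 ≤ N
        rw [levelWeight_one, mul_one]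
        have : μ.factorial ≤ μ.factorial * ns k := Nat.le_mul_of_pos_right _ hnk1
        omega
      · show levelWeight μ w₀ 1 (ns k - 1 + 1) 2 ≤ N
        rw [levelWeight_two, Nat.sub_add_cancel hnk1]; omega
    have hdiff : ∀ i, shiftZ (shiftU₂ c (φs N)) (ts k) i - shiftZ (shiftU₂ c φl) (ts k) i ∈
        maximalIdeal R ^ N := by
      intro i
      fin_cases i
      · show c 0 + ts k - (c 0 + ts k) ∈ _
        rw [sub_self]; exact Ideal.zero_mem _
      · show c 1 - c 1 ∈ _
        rw [sub_self]; exact Ideal.zero_mem _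
      · show c 2 + φs N * c 1 - (c 2 + φl * c 1) ∈ _
        have hrw : c 2 + φs N * c 1 - (c 2 + φl * c 1) = -((φl - φs N) * c 1) := by ring
        rw [hrw]
        exact Submodule.neg_mem _ (Ideal.mul_mem_right _ _ (hlim N))
    have hle := weightedIdealW_le_of_forall_sub_mem_pow (shiftZ (shiftU₂ c φl) (ts k))
      (shiftZ (shiftU₂ c (φs N)) (ts k)) (span_range_eq_of_span_triple _ hgenlk) hWpos hWN hdiff
      (w₀ * μ)
    have hd := (le_weightedIdealW_levelWeight_iff _ hgenlk hdim J hw₀pos Nat.one_pos hnspos).mp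
      (hJW.trans hle)
    -- (d) minimality: the well prepared final system has the smaller polygon
    have hθk : ts k - θ ∈ Ideal.span ({shiftZ (shiftU₂ c φl) θ 1, shiftZ (shiftU₂ c φl) θ 2} : Set R) := by
      rw [span_pair_shiftZ, span_pair_shiftU₂]; exact Ideal.sub_mem _ htk hθ
    have hback : shiftZ (shiftZ (shiftU₂ c φl) θ) (ts k - θ) = shiftZ (shiftU₂ c φl) (ts k) := by
      rw [shiftZ_shiftZ, add_sub_cancel]
    have hfin := forall_pts_of_forall_pts_shiftZ_of_forall_preparedUpTo (shiftZ (shiftU₂ c φl) θ)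
      hgen_l hdim hJμ hmon_l hwpl hθk Nat.one_pos hnspos (w₀ := w₀) (by rw [hback]; exact hd)
    intro e he
    have := hfin e he
    rwa [one_mul, Nat.sub_add_cancel hnk1] at this
  -- hence no Newton point lies below the level `β`: `ε = 0`
  have hlow : lowPts (shiftZ (shiftU₂ c φl) θ) J μ = ∅ := by
    apply Set.eq_empty_of_forall_notMem
    rintro e ⟨he, hlt⟩
    rw [hβ_l] at hlt
    have h1 := hH (spt₁ μ e) e he
    have h2 := hnk (spt₁ μ e)
    have h3 : ns (spt₁ μ e) * (spt₂ μ e + 1) ≤ ns (spt₁ μ e) * betaS c J μ :=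
      Nat.mul_le_mul_left _ hlt
    rw [Nat.mul_add, mul_one] at h3
    omega
  have hε : epsCu (shiftZ (shiftU₂ c φl) θ) J μ = 0 := epsCu_eq_zero_iff.mpr hlow
  -- and `w⁻ = v`: case 2a, contradicting `H`
  have hδαβ : deltaS c J μ = alphaS c J μ + betaS c J μ := by
    obtain ⟨h1, h2⟩ := hvw₁
    rw [hα₁, hδ₁] at h1
    rw [hβ₁] at h2
    rw [h2] at h1; exact h1
  have hγ : gammaMinusS (shiftZ (shiftU₂ c φl) θ) J μ = betaS (shiftZ (shiftU₂ c φl) θ) J μ := by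
    apply le_antisymm
    · obtain ⟨e, he, h1, h2⟩ := exists_pts_v hne_l
      rw [← h2]
      exact gammaMinusS_le he (by rw [h1, h2, hδ_l, hα_l, hβ_l, hδαβ])
    · obtain ⟨e, he, -, h2⟩ := exists_pts_wMinus hne_l
      rw [← h2]
      by_contra hlt
      push Not at hlt
      have : e ∈ lowPts (shiftZ (shiftU₂ c φl) θ) J μ := ⟨he, hlt⟩
      rw [hlow] at this
      exact this
  exact H φl θ hθ (veryWellPrepared_of_case2a hwpl ⟨by rw [hγ, hδ_l, hα_l, hβ_l, hδαβ], hγ⟩ hε)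

end Existence

end Cutkosky2009

end Literature.AlgebraicGeometry.Resolution

end
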